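import Literature.NumberTheory.GaloisRepresentations.HerbrandTheorem
import Literature.NumberTheory.GaloisRepresentations.RamificationGalois
import HarnessLib

/-!
# Serre's Proposition IV.3 (`e' i_{G/H}(σ) = Σ_{s → σ} i_G(s)`) proved: the index formula for Galois quotient data

`Literature.NumberTheory.GaloisRepresentations.HerbrandTheorem` proves Herbrand's theorem
`(G/H)^v = G^v H/H` (Serre, *Local Fields*, Ch. IV §3, Prop. 14) from the single hypothesis
`Literature.IndexFormula 𝔓 𝔮 π` — Serre's Prop. IV.3, the behaviour of the index function
`i_G = Literature.lowerIndex` under passage to the quotient, in the form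
`#H_0 · i_Q(π s) = Σ_{t ∈ H} i_G(s t)` (`H = ker π`, `s ∈ G_0 ∖ H`).  This file **proves that
formula** for "Galois quotient data" `(S, T, G, Q, π : G →* Q, ι : T →+* S)` — `S`, `T` Dedekind,
`G` finite acting faithfully, `𝔓` maximal, `ι` injective and `π`-equivariant with image the
`ker π`-invariants — over any base ring `R₀` with `S` finite over `R₀` and separable residue
extension (`Literature.NumberTheory.GaloisRepresentations.card_mul_lowerIndex_map_eq_finsum`, `Literature.NumberTheory.GaloisRepresentations.indexFormula_of_galoisQuotientData`;
`R₀ = ℤ`: `Literature.NumberTheory.GaloisRepresentations.card_mul_lowerIndex_map_eq_finsum_of_moduleFinite_int`).  The sibling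
`ArtinConductorHerbrandProofs.lean` feeds it with the data of a tower `L/E/K` and discharges
`Literature.NumberTheory.GaloisRepresentations.herbrand_quotient` (and through the tree's reductions the surjectivity `Γ_K^u ↠ Gal(E/K)^u`
and the conductor formula `a_𝔓(ρ) = Σ (g_i/g_0) codim M^{G_i}`).

Serre proves Prop. IV.3 (after Tate) for a finite Galois extension of *complete* discretely
valued fields with separable residue extension, using a monogenic generator `A_L = A_K[x]`
(Ch. III §6, Prop. 12), and globalises by completion (Ch. IV §1, Remark 2).  Mathlib has no
completions of Dedekind domains at primes with their Galois theory, so we give a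
**completion-free proof** along the same lines, entirely inside the global ring `S`:

* `Literature.NumberTheory.GaloisRepresentations.exists_generator_smul_mem_adjoin` — **Serre III §6 Prop. 12 in global form** (proved): for
  a Dedekind domain `S`, finite over the ring `A` of invariants of a finite group `D`, and a
  nonzero maximal ideal `𝔓` *fixed by `D`* with finite residue field of `𝔓 ∩ A`, there are
  `x ∈ S` and `d ∈ A ∖ 𝔓` with `d S ⊆ A[x]` (Serre's Lemmas 3–4: a lift `x` of a primitive
  element of the residue extension with `R(x) ∈ 𝔓 ∖ 𝔓²` by a Taylor expansion, the filtration
  `𝔓ʲ = R(x)ʲ S + 𝔓ʲ⁺¹`, `𝔭 S = 𝔓ᵉ`, and Nakayama's lemma in the form `d ≡ 1 mod 𝔭`).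
* `ordIdeal 𝔓 a ∈ ℕ∞` (scoped notation for Mathlib's `emultiplicity 𝔓 (Ideal.span {a})`, no new
  definition) — the `𝔓`-adic order, with
  `v(ab) = v(a) + v(b)`, `v(Σ) ≥ min`, invariance under automorphisms fixing `𝔓`, and
  `v_𝔓 ∘ ι = e(𝔓|𝔔) · v_𝔔` along an extension of Dedekind domains (`Literature.NumberTheory.GaloisRepresentations.ordIdeal_algebraMap`).
* `Literature.NumberTheory.GaloisRepresentations.lowerIndex_eq_ordIdeal` — **Lemma IV.1.1** (proved): with `x`, `d` as above,
  `i_D(g) = v_𝔓(g x - x)` for all `g ∈ D`.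
* `Literature.NumberTheory.GaloisRepresentations.tate_sum_lowerIndex` — **Tate's argument** (proved): for `N ≤ D` and `s ∈ D`,
  `v_𝔓(s y - y) ≥ Σ_{t ∈ N} i_D(s t)` for every `N`-invariant `y`, with equality for some
  `N`-invariant `y₀` (`f = ∏_{t ∈ N} (X - t x)`, `b = (s f)(x)`, `P - d y = f h`).
* `Literature.NumberTheory.GaloisRepresentations.exists_invariant_sub_mem_pow` — the **decomposition field has `e = f = 1`**, in the form:
  every element fixed by `H ∩ D` is congruent modulo `𝔓ᴹ` to an `H`-invariant element (Chinese
  remainder theorem in `S`, a `H ∩ D`-invariant partition of unity by taking norms, and a sum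
  over coset representatives; Serre I §7 Prop. 21, Neukirch I (9.3)).
* `Literature.NumberTheory.GaloisRepresentations.emultiplicity_map_under_eq_card_inertia` — `e(𝔓 | 𝔓 ∩ T) = #I_𝔓` from Mathlib's Hilbert
  theory (`Ideal.card_inertia_eq_ramificationIdxIn`; finite residue fields are perfect), and
  `Literature.NumberTheory.GaloisRepresentations.emultiplicity_map_under_eq_card_inertia_of_isSeparable` — the same under separability of
  the residue extension, from `card_inertia_eq_ramificationIdxIn_of_isSeparable`
  (`RamificationGalois.lean`).
* `Literature.NumberTheory.GaloisRepresentations.card_mul_lowerIndex_map_eq_finsum` — **Prop. IV.3** for Galois quotient data over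
  Dedekind domains, for *every* `s ∈ G`, granted a base ring `R₀` with `S` finite over `R₀` and `G`
  acting `R₀`-linearly, the separability of the residue extension of `𝔓` over `𝔓 ∩ R₀`, and
  `e(𝔓 | 𝔓 ∩ T) = #H_0`: reduction to `s` in the decomposition group (both sides depend only on
  the coset `s H`; if no lift fixes `𝔓` both sides vanish, by the transitivity of `H` on the
  primes over `𝔓 ∩ T`), the case `s ∈ H` (both sides `∞`), and for `s ∈ D ∖ H` the combination
  of the four items above with the characterization `i_{G/H}(σ) = v_𝔮(σ t₁ - t₁)` for a
  minimizing `t₁ ∈ T` (`Literature.NumberTheory.GaloisRepresentations.lowerIndex_eq_ordIdeal_of_forall_le`);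
  `Literature.NumberTheory.GaloisRepresentations.indexFormula_of_galoisQuotientData` packages it as `IndexFormula 𝔓 (𝔓 ∩ T) π`, and
  `Literature.NumberTheory.GaloisRepresentations.card_mul_lowerIndex_map_eq_finsum_of_moduleFinite_int` is the case `R₀ = ℤ`.

## References

* J.-P. Serre, *Local Fields*, GTM 67, Springer 1979: Ch. I §7, Prop. 20–22 (Hilbert theory,
  decomposition and inertia fields); Ch. III §6, Prop. 12 with Lemmas 3–4 (monogenicity);
  Ch. IV §1, Lemma 1, Prop. 2, Prop. 3 (after Tate) and Remark 2 (globalisation).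
  [SerreLocalFields1979]
* J. Neukirch, *Algebraic Number Theory*, Springer 1999, Ch. I §9, Prop. (9.3) (decomposition
  field), Ch. II §10 (higher ramification). [NeukirchANT1999]
-/

noncomputable section

namespace Literature.NumberTheory.GaloisRepresentations

/-! ### Monogenicity at a stable prime (Serre III §6 Prop. 12, global form) -/

section GlobMono

open Polynomial
open scoped Pointwise

variable {A S : Type*} [CommRing A] [CommRing S] [Algebra A S]

/-! #### Dedekind lemmas at a nonzero prime -/

section Dedekind

variable [IsDedekindDomain S] (𝔓 : Ideal S)

/-- In a Dedekind domain a nonzero prime `𝔓` has an element `h ∈ 𝔓 ∖ 𝔓²`. [folklore] -/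
theorem exists_mem_not_mem_sq [𝔓.IsPrime] (h𝔓 : 𝔓 ≠ ⊥) : ∃ h ∈ 𝔓, h ∉ 𝔓 ^ 2 := by
  have hlt : 𝔓 ^ 2 < 𝔓 ^ 1 :=
    Ideal.pow_right_strictAnti 𝔓 h𝔓 (Ideal.IsPrime.ne_top inferInstance) (by norm_num)
  rw [pow_one] at hlt
  obtain ⟨h, hh, hh2⟩ := SetLike.exists_of_lt hlt
  exact ⟨h, hh, hh2⟩

/-- `u ∉ 𝔓`, `u h ∈ 𝔓ⁿ` imply `h ∈ 𝔓ⁿ` (Dedekind domain, `𝔓` a nonzero prime). [folklore] -/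
theorem mem_pow_of_mul_mem_pow [𝔓.IsPrime] (h𝔓 : 𝔓 ≠ ⊥) {u h : S} (hu : u ∉ 𝔓) {n : ℕ}
    (huh : u * h ∈ 𝔓 ^ n) : h ∈ 𝔓 ^ n := by
  have hprime : Prime 𝔓 := Ideal.prime_of_isPrime h𝔓 inferInstance
  rw [← Ideal.dvd_span_singleton] at huh ⊢
  rw [← Ideal.span_singleton_mul_span_singleton] at huh
  refine hprime.pow_dvd_of_dvd_mul_left n ?_ huh
  rwa [Ideal.dvd_span_singleton]

/-- If `π ∈ 𝔓 ∖ 𝔓²` then `𝔓ʲ ⊆ (πʲ) + 𝔓ʲ⁺¹` (Dedekind domain, `𝔓` maximal): `(π) = 𝔓 𝔞` with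
`𝔞 + 𝔓 = 1`.  Ref: Serre, *Local Fields*, Ch. III §6, proof of Lemma 3 (filtration of `B` by the
`πʲ`). [folklore] -/
theorem pow_le_span_pow_sup [𝔓.IsMaximal] {π : S} (hπ : π ∈ 𝔓) (hπ2 : π ∉ 𝔓 ^ 2)
    (j : ℕ) : 𝔓 ^ j ≤ Ideal.span {π ^ j} ⊔ 𝔓 ^ (j + 1) := by
  -- `(π) = 𝔓 * 𝔞` with `𝔞` not contained in `𝔓`
  obtain ⟨𝔞, h𝔞⟩ : 𝔓 ∣ Ideal.span {π} := Ideal.dvd_span_singleton.mpr hπ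
  have h𝔞𝔓 : ¬ 𝔞 ≤ 𝔓 := fun hle => by
    apply hπ2
    rw [← Ideal.dvd_span_singleton, h𝔞, pow_two]
    exact mul_dvd_mul_left 𝔓 (Ideal.dvd_iff_le.mpr hle)
  have hcop : 𝔓 ⊔ 𝔞 = ⊤ :=
    (Ideal.IsMaximal.out : IsCoatom 𝔓).2 _ (lt_of_le_of_ne le_sup_left fun h => h𝔞𝔓 (h ▸ le_sup_right))
  have hcopj : 𝔓 ⊔ 𝔞 ^ j = ⊤ := Ideal.sup_pow_eq_top hcop
  apply le_of_eq
  calc 𝔓 ^ j = 𝔓 ^ j * (𝔞 ^ j ⊔ 𝔓) := by rw [sup_comm, hcopj, Ideal.mul_top]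
    _ = 𝔓 ^ j * 𝔞 ^ j ⊔ 𝔓 ^ j * 𝔓 := Ideal.mul_sup _ _ _
    _ = Ideal.span {π ^ j} ⊔ 𝔓 ^ (j + 1) := by
        rw [← mul_pow, ← h𝔞, Ideal.span_singleton_pow, pow_succ]

end Dedekind

/-! #### Norms into the ring of invariants -/

variable (D : Type*) [Group D] [MulSemiringAction D S]

variable (A) in
/-- A nonzero `D`-stable... more precisely: for `s ∈ 𝔓` nonzero, the norm `∏_g g • s` is a nonzero
element of `𝔓` coming from `A` (`A` = invariants); hence `𝔓 ∩ A ≠ 0` extends to `(𝔓 ∩ A) S ≠ 0`.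
[folklore] -/
theorem map_under_ne_bot [IsDomain S] [Finite D] [Algebra.IsInvariant A S D] (𝔓 : Ideal S)
    (h𝔓 : 𝔓 ≠ ⊥) : (𝔓.under A).map (algebraMap A S) ≠ ⊥ := by
  classical
  haveI := Fintype.ofFinite D
  obtain ⟨s, hs, hs0⟩ := Submodule.exists_mem_ne_zero_of_ne_bot h𝔓
  set n := ∏ g : D, g • s with hn
  have hninv : ∀ h : D, h • n = n := fun h => by
    rw [hn, Finset.smul_prod']
    exact Fintype.prod_bijective (h * ·) (Group.mulLeft_bijective h) _ _ fun g => (mul_smul h g s).symm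
  obtain ⟨a, ha⟩ := Algebra.IsInvariant.isInvariant (A := A) n hninv
  have hn𝔓 : n ∈ 𝔓 := by
    obtain ⟨k, hk⟩ := Finset.dvd_prod_of_mem (fun g : D => g • s) (Finset.mem_univ (1 : D))
    rw [hn, hk, one_smul]
    exact Ideal.mul_mem_right _ _ hs
  have hn0 : n ≠ 0 := by
    rw [hn, Finset.prod_ne_zero_iff]
    intro g _ hg
    exact hs0 (by simpa using congrArg (g⁻¹ • ·) hg)
  intro hbot
  have : n ∈ (𝔓.under A).map (algebraMap A S) := by
    rw [← ha]
    exact Ideal.mem_map_of_mem _ (by rw [Ideal.under_def, Ideal.mem_comap, ha]; exact hn𝔓)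
  rw [hbot, Ideal.mem_bot] at this
  exact hn0 this

variable (A) in
/-- If `𝔓` is `D`-stable then it is the only prime of `S` over `𝔭 = 𝔓 ∩ A`, so `𝔭 S = 𝔓ᵉ`; we
record `𝔓ᵉ ≤ 𝔭 S` for some `e`.  Ref: Serre, *Local Fields*, Ch. I §7, Prop. 19 (transitivity on
the primes above `𝔭`). [folklore] -/
theorem exists_pow_le_map_under [IsDedekindDomain S] [Finite D] [Algebra.IsInvariant A S D]
    [SMulCommClass D A S] (𝔓 : Ideal S) [𝔓.IsMaximal] (h𝔓 : 𝔓 ≠ ⊥) (hstab : ∀ g : D, g • 𝔓 = 𝔓) :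
    ∃ e : ℕ, 𝔓 ^ e ≤ (𝔓.under A).map (algebraMap A S) := by
  classical
  haveI : Algebra.IsIntegral A S := Algebra.IsInvariant.isIntegral A S D
  haveI h𝔭max : (𝔓.under A).IsMaximal := Ideal.IsMaximal.under A 𝔓
  have hne := map_under_ne_bot A D 𝔓 h𝔓
  set I := (𝔓.under A).map (algebraMap A S) with hI
  have hall : ∀ Q ∈ UniqueFactorizationMonoid.normalizedFactors I, Q = 𝔓 := by
    intro Q hQ
    haveI hQprime : Q.IsPrime := Ideal.isPrime_of_prime
      (UniqueFactorizationMonoid.prime_of_normalized_factor Q hQ)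
    have hQle : I ≤ Q :=
      Ideal.dvd_iff_le.mp (UniqueFactorizationMonoid.dvd_of_mem_normalizedFactors hQ)
    have hQunder : Q.under A = 𝔓.under A :=
      (h𝔭max.eq_of_le (Ideal.IsPrime.ne_top inferInstance) (Ideal.map_le_iff_le_comap.mp hQle)).symm
    obtain ⟨g, hg⟩ := Algebra.IsInvariant.exists_smul_of_under_eq A S D 𝔓 Q hQunder.symm
    rw [hg, hstab]
  refine ⟨(UniqueFactorizationMonoid.normalizedFactors I).card, le_of_eq ?_⟩
  conv_rhs => rw [← Ideal.prod_normalizedFactors_eq_self hne,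
    Multiset.eq_replicate_of_mem hall, Multiset.prod_replicate]

/-! #### Serre III §6 Prop. 12, global form -/

/-- **Serre III §6 Prop. 12, global form ("`B = A[x]` up to a unit at `𝔓`").**  Let `S` be a
Dedekind domain, finite over `A` whose image is the ring of invariants of a finite group `D`
(`Algebra.IsInvariant A S D`), and `𝔓` a nonzero maximal ideal of `S` fixed by `D` such that the
residue extension of `𝔓` over `𝔭 = 𝔓 ∩ A` is separable (e.g. `A/𝔭` finite or perfect).  Then there are `x ∈ S` and `d ∈ A` with `d ∉ 𝔓` and
`d S ⊆ A[x]`: every `b ∈ S` satisfies `d b = P(x)` for some `P ∈ A[X]`.  (Locally at `𝔭`, where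
`S_𝔭` is a discrete valuation ring because `𝔓` is the only prime over `𝔭`, this is Serre's
`B = A[x]`.)  Proof (Serre, Lemmas 3–4): choose `x` lifting a primitive element of the (separable)
residue extension such that `R(x) ∈ 𝔓 ∖ 𝔓²` for a monic lift `R ∈ A[X]` of its minimal polynomial
(Taylor expansion `R(x₀ + h) = R(x₀) + h R'(x₀) + c h²` with `h ∈ 𝔓 ∖ 𝔓²`, `R'(x₀) ∉ 𝔓`); then
`S = A[x] + 𝔓ⁿ` for all `n` (filtration `𝔓ʲ = R(x)ʲ S + 𝔓ʲ⁺¹`), in particular `S = A[x] + 𝔭S`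
(`𝔭 S = 𝔓ᵉ`), and Nakayama's lemma gives `d ≡ 1 mod 𝔭` with `d S ⊆ A[x]`.
Ref: Serre, *Local Fields*, Ch. III §6, Prop. 12 with Lemmas 3 and 4.
[cite: SerreLocalFields1979, Ch. III §6 Prop. 12] -/
theorem exists_generator_smul_mem_adjoin [IsDedekindDomain S] [Finite D] [Algebra.IsInvariant A S D]
    [SMulCommClass D A S] [Module.Finite A S] (𝔓 : Ideal S) [𝔓.IsMaximal] (h𝔓 : 𝔓 ≠ ⊥) (hstab : ∀ g : D, g • 𝔓 = 𝔓)
    [Algebra.IsSeparable (A ⧸ 𝔓.under A) (S ⧸ 𝔓)] :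
    ∃ (x : S) (d : A), algebraMap A S d ∉ 𝔓 ∧ ∀ b : S, ∃ P : A[X], d • b = aeval x P := by
  classical
  haveI : Algebra.IsIntegral A S := Algebra.IsInvariant.isIntegral A S D
  set 𝔭 := 𝔓.under A with h𝔭def
  haveI h𝔭max : 𝔭.IsMaximal := Ideal.IsMaximal.under A 𝔓
  -- residue fields
  letI : Field (A ⧸ 𝔭) := Ideal.Quotient.field 𝔭
  letI : Field (S ⧸ 𝔓) := Ideal.Quotient.field 𝔓
  haveI : Algebra.IsSeparable (A ⧸ 𝔭) (S ⧸ 𝔓) := ‹Algebra.IsSeparable (A ⧸ 𝔓.under A) (S ⧸ 𝔓)›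
  -- reduction of polynomials
  have hcomp : (algebraMap (A ⧸ 𝔭) (S ⧸ 𝔓)).comp (Ideal.Quotient.mk 𝔭) =
      (Ideal.Quotient.mk 𝔓).comp (algebraMap A S) :=
    RingHom.ext fun a => Ideal.Quotient.algebraMap_mk_of_liesOver 𝔓 𝔭 a
  have hred : ∀ (P : A[X]) (z : S), Ideal.Quotient.mk 𝔓 (aeval z P) =
      aeval (Ideal.Quotient.mk 𝔓 z) (P.map (Ideal.Quotient.mk 𝔭)) := fun P z =>
    Polynomial.map_aeval_eq_aeval_map hcomp P z
  -- a primitive element `α` of the residue extension; lifts generate `S` modulo `𝔓`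
  obtain ⟨α, hα⟩ := Field.exists_primitive_element (A ⧸ 𝔭) (S ⧸ 𝔓)
  have hαint : IsIntegral (A ⧸ 𝔭) α := Algebra.IsIntegral.isIntegral α
  have hgen : ∀ z : S, Ideal.Quotient.mk 𝔓 z = α → ∀ b : S, ∃ P : A[X], b - aeval z P ∈ 𝔓 := by
    intro z hz b
    have hb : Ideal.Quotient.mk 𝔓 b ∈ (IntermediateField.adjoin (A ⧸ 𝔭) {α}).toSubalgebra := by
      rw [hα]; trivial
    rw [IntermediateField.adjoin_simple_toSubalgebra_of_isAlgebraic hαint.isAlgebraic,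
      Algebra.adjoin_singleton_eq_range_aeval] at hb
    obtain ⟨p, hp⟩ := hb
    obtain ⟨P, hP⟩ := Polynomial.map_surjective (Ideal.Quotient.mk 𝔭) Ideal.Quotient.mk_surjective p
    refine ⟨P, ?_⟩
    rw [← Ideal.Quotient.eq_zero_iff_mem, map_sub, hred, hz, hP]
    change Ideal.Quotient.mk 𝔓 b - aeval α p = 0
    rw [← hp]
    exact sub_self _
  obtain ⟨x₀, hx₀⟩ := Ideal.Quotient.mk_surjective α
  -- a monic lift `R` of the minimal polynomial of `α`; `R(z) ∈ 𝔓`, `R'(z) ∉ 𝔓` for lifts `z`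
  obtain ⟨R, hRmap, -, -⟩ := Polynomial.lifts_and_degree_eq_and_monic
    (Polynomial.map_surjective (Ideal.Quotient.mk 𝔭) Ideal.Quotient.mk_surjective
      (minpoly (A ⧸ 𝔭) α)) (minpoly.monic hαint)
  have hRx : ∀ z : S, Ideal.Quotient.mk 𝔓 z = α → aeval z R ∈ 𝔓 := fun z hz => by
    rw [← Ideal.Quotient.eq_zero_iff_mem, hred, hz, hRmap, minpoly.aeval]
  have hR'x : ∀ z : S, Ideal.Quotient.mk 𝔓 z = α → aeval z (derivative R) ∉ 𝔓 := fun z hz => by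
    rw [← Ideal.Quotient.eq_zero_iff_mem, hred, hz, ← Polynomial.derivative_map, hRmap]
    exact (Algebra.IsSeparable.isSeparable (A ⧸ 𝔭) α).aeval_derivative_ne_zero (minpoly.aeval _ _)
  -- adjust `x₀` so that `R(x) ∈ 𝔓 ∖ 𝔓²` (Serre's Lemma 4)
  obtain ⟨x, hxα, hRx𝔓, hRx2⟩ : ∃ x : S, Ideal.Quotient.mk 𝔓 x = α ∧ aeval x R ∈ 𝔓 ∧
      aeval x R ∉ 𝔓 ^ 2 := by
    by_cases h2 : aeval x₀ R ∈ 𝔓 ^ 2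
    · obtain ⟨h, hh, hh2⟩ := exists_mem_not_mem_sq 𝔓 h𝔓
      have hxα : Ideal.Quotient.mk 𝔓 (x₀ + h) = α := by
        rw [map_add, hx₀, Ideal.Quotient.eq_zero_iff_mem.mpr hh, add_zero]
      refine ⟨x₀ + h, hxα, hRx _ hxα, fun hmem => ?_⟩
      obtain ⟨c, hc⟩ := Polynomial.binomExpansion (R.map (algebraMap A S)) x₀ h
      rw [Polynomial.derivative_map, Polynomial.eval_map_algebraMap,
        Polynomial.eval_map_algebraMap, Polynomial.eval_map_algebraMap] at hc
      rw [hc] at hmem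
      have hsq : c * h ^ 2 ∈ 𝔓 ^ 2 := Ideal.mul_mem_left _ _ (Ideal.pow_mem_pow hh 2)
      have hmid : aeval x₀ (derivative R) * h ∈ 𝔓 ^ 2 := by
        have key : aeval x₀ (derivative R) * h =
            (aeval x₀ R + aeval x₀ (derivative R) * h + c * h ^ 2) - aeval x₀ R - c * h ^ 2 := by
          ring
        rw [key]
        exact Ideal.sub_mem _ (Ideal.sub_mem _ hmem h2) hsq
      exact hh2 (mem_pow_of_mul_mem_pow 𝔓 h𝔓 (hR'x x₀ hx₀) hmid)
    · exact ⟨x₀, hx₀, hRx x₀ hx₀, h2⟩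
  -- `S = A[x] + 𝔓ⁿ` for all `n` (Serre's Lemma 3)
  have hfilt : ∀ (n : ℕ) (b : S), ∃ P : A[X], b - aeval x P ∈ 𝔓 ^ n := by
    intro n
    induction n with
    | zero => intro b; exact ⟨0, by simp⟩
    | succ n ih =>
      intro b
      obtain ⟨P, hP⟩ := ih b
      obtain ⟨c, q, hq, hcq⟩ := Ideal.mem_span_singleton_sup.mp
        (pow_le_span_pow_sup 𝔓 hRx𝔓 hRx2 n hP)
      obtain ⟨P₁, hP₁⟩ := hgen x hxα c
      refine ⟨P + P₁ * R ^ n, ?_⟩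
      have : b - aeval x (P + P₁ * R ^ n) = (c - aeval x P₁) * (aeval x R) ^ n + q := by
        rw [map_add, map_mul, map_pow]
        linear_combination (-1 : S) * hcq
      rw [this]
      refine Ideal.add_mem _ ?_ hq
      rw [pow_succ']
      exact Ideal.mul_mem_mul hP₁ (Ideal.pow_mem_pow hRx𝔓 n)
  -- `S = A[x] + 𝔭 S` and Nakayama
  obtain ⟨e, he⟩ := exists_pow_le_map_under A D 𝔓 h𝔓 hstab
  set M : Submodule A S := LinearMap.range (aeval x : A[X] →ₐ[A] S).toLinearMap with hMdef
  have hsup : (⊤ : Submodule A S) ≤ M ⊔ 𝔭 • ⊤ := by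
    rintro b -
    obtain ⟨P, hP⟩ := hfilt e b
    refine Submodule.mem_sup.mpr ⟨aeval x P, ⟨P, rfl⟩, b - aeval x P, ?_, add_sub_cancel _ _⟩
    rw [Ideal.smul_top_eq_map, Submodule.restrictScalars_mem]
    exact he hP
  haveI : Module.Finite A (S ⧸ M) := Module.Finite.quotient A M
  have hN : (⊤ : Submodule A (S ⧸ M)) ≤ 𝔭 • ⊤ := by
    have h := Submodule.map_mono (f := M.mkQ) hsup
    rwa [Submodule.map_sup, Submodule.mkQ_map_self, bot_sup_eq, Submodule.map_smul'',
      Submodule.map_top, Submodule.range_mkQ] at h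
  obtain ⟨d, hd1, hd⟩ := Submodule.exists_sub_one_mem_and_smul_eq_zero_of_fg_of_le_smul 𝔭
    (⊤ : Submodule A (S ⧸ M)) Module.Finite.fg_top hN
  refine ⟨x, d, fun hd𝔓 => ?_, fun b => ?_⟩
  · have hd𝔭 : d ∈ 𝔭 := hd𝔓
    have : (1 : A) ∈ 𝔭 := by simpa using Ideal.sub_mem _ hd𝔭 hd1
    exact h𝔭max.ne_top ((Ideal.eq_top_iff_one _).mpr this)
  · have h := hd (Submodule.Quotient.mk b) trivial
    rw [← Submodule.Quotient.mk_smul, Submodule.Quotient.mk_eq_zero] at h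
    obtain ⟨P, hP⟩ := h
    exact ⟨P, hP.symm⟩

end GlobMono

/-! ### The `𝔓`-adic order and Serre's Prop. IV.3 in the decomposition-local form (after Tate) -/

section PadicOrder

open scoped Pointwise

variable {S : Type*} [CommRing S] [IsDedekindDomain S] (𝔓 : Ideal S)

/-- Notation (this file and its importers, inside `namespace Literature`): the `𝔓`-adic order
`ordIdeal 𝔓 a = v_𝔓(a) ∈ ℕ ∪ {∞}` of an element of a Dedekind domain is Mathlib's multiplicity
`emultiplicity 𝔓 (Ideal.span {a})` of the prime `𝔓` in the principal ideal `(a)` (`= ∞` for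
`a = 0`); a notation rather than a definition, so that all statements below are statements about
`emultiplicity`.  Ref: Serre, *Local Fields*, Ch. I §3 (the discrete valuations attached to the
primes of a Dedekind domain). [folklore] -/
scoped notation3 "ordIdeal " 𝔓:max a:max => emultiplicity 𝔓 (Ideal.span {a})

variable {𝔓}

/-- `n ≤ v_𝔓(a) ↔ a ∈ 𝔓ⁿ`.  Ref: Serre, *Local Fields*, Ch. I §3. [folklore] -/
theorem le_ordIdeal_iff_mem_pow {a : S} {n : ℕ} : (n : ℕ∞) ≤ ordIdeal 𝔓 a ↔ a ∈ 𝔓 ^ n := by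
  rw [← pow_dvd_iff_le_emultiplicity, Ideal.dvd_span_singleton]

/-- Two elements lying in the same powers of `𝔓` have the same order. [folklore] -/
theorem ordIdeal_eq_ordIdeal_of_iff {a b : S} (h : ∀ n : ℕ, a ∈ 𝔓 ^ n ↔ b ∈ 𝔓 ^ n) :
    ordIdeal 𝔓 a = ordIdeal 𝔓 b := by
  refine le_antisymm ?_ ?_ <;> refine ENat.forall_natCast_le_iff_le.mp fun n hn => ?_
  · exact le_ordIdeal_iff_mem_pow.mpr ((h n).mp (le_ordIdeal_iff_mem_pow.mp hn))
  · exact le_ordIdeal_iff_mem_pow.mpr ((h n).mpr (le_ordIdeal_iff_mem_pow.mp hn))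

omit [IsDedekindDomain S] in
/-- `v_𝔓(0) = ∞`. [folklore] -/
@[simp]
theorem ordIdeal_zero : ordIdeal 𝔓 (0 : S) = ⊤ := by
  simp

omit [IsDedekindDomain S] in
/-- `v_𝔓(-a) = v_𝔓(a)`. [folklore] -/
@[simp]
theorem ordIdeal_neg (a : S) : ordIdeal 𝔓 (-a) = ordIdeal 𝔓 a := by
  simp only [Ideal.span_singleton_neg]

omit [IsDedekindDomain S] in
/-- `v_𝔓(a - b) = v_𝔓(b - a)`. [folklore] -/
theorem ordIdeal_sub_comm (a b : S) : ordIdeal 𝔓 (a - b) = ordIdeal 𝔓 (b - a) := by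
  rw [← neg_sub, ordIdeal_neg]

/-- `v_𝔓(a b) = v_𝔓(a) + v_𝔓(b)` for a nonzero prime `𝔓`.
Ref: Serre, *Local Fields*, Ch. I §3. [folklore] -/
theorem ordIdeal_mul [𝔓.IsPrime] (h𝔓 : 𝔓 ≠ ⊥) (a b : S) :
    ordIdeal 𝔓 (a * b) = ordIdeal 𝔓 a + ordIdeal 𝔓 b := by
  rw [← Ideal.span_singleton_mul_span_singleton]
  exact emultiplicity_mul (Ideal.prime_of_isPrime h𝔓 inferInstance)

/-- `v_𝔓(∏ aᵢ) = Σ v_𝔓(aᵢ)` for a nonzero prime `𝔓`. [folklore] -/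
theorem ordIdeal_prod [𝔓.IsPrime] (h𝔓 : 𝔓 ≠ ⊥) {ι : Type*} (s : Finset ι) (f : ι → S) :
    ordIdeal 𝔓 (∏ i ∈ s, f i) = ∑ i ∈ s, ordIdeal 𝔓 (f i) := by
  rw [← Ideal.prod_span_singleton]
  exact Finset.emultiplicity_prod (Ideal.prime_of_isPrime h𝔓 inferInstance) s _

/-- `v_𝔓(a) = 0 ↔ a ∉ 𝔓`. [folklore] -/
theorem ordIdeal_eq_zero_iff {a : S} : ordIdeal 𝔓 a = 0 ↔ a ∉ 𝔓 := by
  rw [emultiplicity_eq_zero, Ideal.dvd_span_singleton]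

/-- A sum of elements of order `≥ n` has order `≥ n`. [folklore] -/
theorem le_ordIdeal_sum {ι : Type*} (s : Finset ι) (f : ι → S) {n : ℕ}
    (h : ∀ i ∈ s, (n : ℕ∞) ≤ ordIdeal 𝔓 (f i)) : (n : ℕ∞) ≤ ordIdeal 𝔓 (∑ i ∈ s, f i) := by
  rw [le_ordIdeal_iff_mem_pow]
  exact Ideal.sum_mem _ fun i hi => le_ordIdeal_iff_mem_pow.mp (h i hi)

/-- The order is invariant under an automorphism fixing `𝔓`. [folklore] -/
theorem ordIdeal_smul {D : Type*} [Group D] [MulSemiringAction D S] {g : D} (hg : g • 𝔓 = 𝔓)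
    (a : S) : ordIdeal 𝔓 (g • a) = ordIdeal 𝔓 a := by
  refine ordIdeal_eq_ordIdeal_of_iff fun n => ?_
  have hgn : g • 𝔓 ^ n = 𝔓 ^ n := by rw [smul_pow', hg]
  constructor
  · intro h
    rw [← hgn, Ideal.smul_mem_pointwise_smul_iff] at h
    exact h
  · intro h
    rw [← hgn, Ideal.smul_mem_pointwise_smul_iff]
    exact h

/-- `v_𝔓(g • a - a) = v_𝔓(a - g⁻¹ • a)`-type symmetry: `v_𝔓(g a - a) = v_𝔓(g⁻¹ a - a)`. [folklore] -/
theorem ordIdeal_inv_smul_sub {D : Type*} [Group D] [MulSemiringAction D S] {g : D} (hg : g • 𝔓 = 𝔓)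
    (a : S) : ordIdeal 𝔓 (g⁻¹ • a - a) = ordIdeal 𝔓 (g • a - a) := by
  rw [← ordIdeal_smul hg (g⁻¹ • a - a), smul_sub, smul_inv_smul, ordIdeal_sub_comm]

end PadicOrder

/-! ### Minimizers: `i_G(s) = v_𝔓(s x - x)` for a generator `x` (Serre IV §1, Lemma 1) -/

section Minimizer

open Polynomial
open scoped Pointwise

variable {A S : Type*} [CommRing A] [CommRing S] [Algebra A S] [IsDedekindDomain S]
  {D : Type*} [Group D] [MulSemiringAction D S] [SMulCommClass D A S] {𝔓 : Ideal S}

omit [IsDedekindDomain S] in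
/-- Polynomials with coefficients from `A` are fixed by `D`: `g • P(z) = P(g • z)`. [folklore] -/
theorem smul_aeval (g : D) (z : S) (P : A[X]) : g • aeval z P = aeval (g • z) P := by
  rw [← Polynomial.eval_map_algebraMap, ← Polynomial.eval_map_algebraMap,
    ← Polynomial.smul_eval_smul, Polynomial.smul_eq_map]
  congr 1
  rw [Polynomial.map_map]
  congr 1
  ext a
  exact smul_algebraMap g a

/-- **Serre IV §1 Lemma 1 (global form).**  If `d S ⊆ A[x]` with `d ∉ 𝔓` (the conclusion of
`exists_generator_smul_mem_adjoin`), then for every `g ∈ D` fixing `𝔓` and every `b ∈ S`,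
`v_𝔓(g b - b) ≥ v_𝔓(g x - x)`: the ideal generated by the `g b - b` is `(g x - x)` locally at `𝔓`.
Ref: Serre, *Local Fields*, Ch. IV §1, Lemma 1 (b) ⇔ c)). [cite: SerreLocalFields1979, Ch. IV §1 Lemma 1] -/
theorem ordIdeal_smul_sub_le [𝔓.IsPrime] (h𝔓 : 𝔓 ≠ ⊥) {x : S} {d : A} (hd : algebraMap A S d ∉ 𝔓)
    (hgen : ∀ b : S, ∃ P : A[X], d • b = aeval x P) (g : D) (b : S) :
    ordIdeal 𝔓 (g • x - x) ≤ ordIdeal 𝔓 (g • b - b) := by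
  obtain ⟨P, hP⟩ := hgen b
  have hdb : algebraMap A S d * (g • b - b) = aeval (g • x) P - aeval x P := by
    rw [mul_sub, ← Algebra.smul_def, ← Algebra.smul_def, ← hP, ← smul_aeval g x P, ← hP,
      smul_comm g d b]
  obtain ⟨q, hq⟩ := Polynomial.sub_dvd_eval_sub (g • x) x (P.map (algebraMap A S))
  rw [Polynomial.eval_map_algebraMap, Polynomial.eval_map_algebraMap] at hq
  have h := congrArg (fun c => ordIdeal 𝔓 c) hdb
  rw [hq, ordIdeal_mul h𝔓, ordIdeal_mul h𝔓, ordIdeal_eq_zero_iff.mpr hd, zero_add] at h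
  rw [h]
  exact le_self_add

/-- With `x`, `d` as above and `𝔓` fixed by `D`: **`i_D(g) = v_𝔓(g x - x)`** for every `g ∈ D`
(including `g = 1`, both sides `∞`).  Ref: Serre, *Local Fields*, Ch. IV §1, after Prop. 1
(`i_G(s) = v_L(s(x) - x)`). [cite: SerreLocalFields1979, Ch. IV §1 Lemma 1] -/
theorem lowerIndex_eq_ordIdeal [𝔓.IsPrime] (h𝔓 : 𝔓 ≠ ⊥) (hstab : ∀ g : D, g • 𝔓 = 𝔓) {x : S} {d : A}
    (hd : algebraMap A S d ∉ 𝔓) (hgen : ∀ b : S, ∃ P : A[X], d • b = aeval x P) (g : D) :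
    lowerIndex 𝔓 D g = ordIdeal 𝔓 (g • x - x) := by
  refine le_antisymm ?_ ?_ <;> refine ENat.forall_natCast_le_iff_le.mp fun n hn => ?_ <;>
    rcases n with _ | n
  · exact bot_le
  · rw [le_ordIdeal_iff_mem_pow]
    rw [Nat.cast_succ, add_one_le_lowerIndex_iff] at hn
    exact hn.2 x
  · exact bot_le
  · have hb : ∀ b : S, g • b - b ∈ 𝔓 ^ (n + 1) := fun b =>
      le_ordIdeal_iff_mem_pow.mp (le_trans hn (ordIdeal_smul_sub_le h𝔓 hd hgen g b))
    rw [Nat.cast_succ, add_one_le_lowerIndex_iff]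
    exact ⟨hstab g, fun b => hb b⟩

end Minimizer

/-! ### The order along a finite extension: `v_𝔓(z) = e(𝔓|𝔔) v_𝔔(z)` -/

section OrderExtension

variable {Z S : Type*} [CommRing Z] [CommRing S] [Algebra Z S] [IsDedekindDomain Z]
  [IsDedekindDomain S] {𝔓 : Ideal S} {𝔔 : Ideal Z}

/-- For Dedekind domains `Z → S`, a nonzero prime `𝔓` of `S` over the maximal ideal `𝔔` of `Z`
(`𝔔 S ≤ 𝔓`), and `z ∈ Z`: `v_𝔓(z) = v_𝔔(z) · e` with `e = v_𝔓(𝔔 S)` the ramification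
index of `𝔓` over `𝔔`.  Proof: `(z) = 𝔔ᵏ J` with `𝔔 ∤ J`, so `J + 𝔔 = 1`, `J S + 𝔔 S = 1`, `𝔓 ∤ J S`.
Ref: Serre, *Local Fields*, Ch. I §4 (`e_𝔓`, `v_𝔓` restricted to `K` is `e_𝔓 v_𝔭`). [folklore] -/
theorem ordIdeal_algebraMap [𝔓.IsPrime] (h𝔓 : 𝔓 ≠ ⊥) [𝔔.IsMaximal] (h𝔔 : 𝔔 ≠ ⊥)
    (hle : 𝔔.map (algebraMap Z S) ≤ 𝔓) (z : Z) :
    ordIdeal 𝔓 (algebraMap Z S z) =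
      ordIdeal 𝔔 z * emultiplicity 𝔓 (𝔔.map (algebraMap Z S)) := by
  have h𝔓prime : Prime 𝔓 := Ideal.prime_of_isPrime h𝔓 inferInstance
  have h𝔔prime : Prime 𝔔 := Ideal.prime_of_isPrime h𝔔 inferInstance
  have he0 : emultiplicity 𝔓 (𝔔.map (algebraMap Z S)) ≠ 0 :=
    (emultiplicity_pos_of_dvd (Ideal.dvd_iff_le.mpr hle)).ne'
  by_cases hz : z = 0
  · subst hz
    rw [map_zero, ordIdeal_zero, ordIdeal_zero, ENat.top_mul he0]
  -- `(z) = 𝔔ᵏ * J` with `𝔔 ∤ J`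
  have hfin : FiniteMultiplicity 𝔔 (Ideal.span {z}) :=
    FiniteMultiplicity.of_not_isUnit (fun hu => Ideal.IsPrime.ne_top inferInstance
      (Ideal.isUnit_iff.mp hu)) (by rw [Ne, Ideal.zero_eq_bot, Ideal.span_singleton_eq_bot]; exact hz)
  obtain ⟨J, hJ, hJ𝔔⟩ := hfin.exists_eq_pow_mul_and_not_dvd
  have hordz : ordIdeal 𝔔 z = multiplicity 𝔔 (Ideal.span {z}) := hfin.emultiplicity_eq_multiplicity
  -- `J S` is prime to `𝔓`
  have hJS : emultiplicity 𝔓 (J.map (algebraMap Z S)) = 0 := by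
    rw [emultiplicity_eq_zero, Ideal.dvd_iff_le]
    intro hJle
    have hcop : J ⊔ 𝔔 = ⊤ := by
      rw [sup_comm]
      exact (Ideal.IsMaximal.out : IsCoatom 𝔔).2 _ (lt_of_le_of_ne le_sup_left fun h =>
        hJ𝔔 (Ideal.dvd_iff_le.mpr (h ▸ le_sup_right)))
    have : (⊤ : Ideal S) ≤ 𝔓 := by
      rw [← Ideal.map_top (algebraMap Z S), ← hcop, Ideal.map_sup]
      exact sup_le hJle hle
    exact Ideal.IsPrime.ne_top inferInstance (top_le_iff.mp this)
  -- compute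
  have hspan : Ideal.span {algebraMap Z S z} = (Ideal.span {z}).map (algebraMap Z S) := by
    rw [Ideal.map_span, Set.image_singleton]
  rw [hordz, hspan]
  conv_lhs => rw [hJ, Ideal.map_mul, Ideal.map_pow]
  rw [emultiplicity_mul h𝔓prime, emultiplicity_pow h𝔓prime, hJS, add_zero]

end OrderExtension

/-! ### Tate's argument (Serre IV §1 Prop. 3): `v_𝔓(∏_t (x - s t x))` -/

section Tate

open Polynomial
open scoped Pointwise

variable {A S : Type*} [CommRing A] [CommRing S] [Algebra A S] [IsDedekindDomain S]
  {D : Type*} [Group D] [MulSemiringAction D S] [SMulCommClass D A S] (N : Subgroup D)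

omit [IsDedekindDomain S] in
/-- The polynomial `f = ∏_{t ∈ N} (X - t x)` under `g`: `g • f = ∏_t (X - g t x)`. [folklore] -/
theorem smul_prod_X_sub_C [Fintype N] (g : D) (x : S) :
    g • ∏ t : N, (X - C ((t : D) • x)) = ∏ t : N, (X - C (g • (t : D) • x)) := by
  rw [Finset.smul_prod']
  refine Finset.prod_congr rfl fun t _ => ?_
  rw [smul_sub, Polynomial.smul_X, Polynomial.smul_C]

omit [IsDedekindDomain S] in
/-- `∏_{t ∈ N} (X - t x)` is invariant under `N`. [folklore] -/
theorem subgroup_smul_prod_X_sub_C [Fintype N] (t₀ : N) (x : S) :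
    (t₀ : D) • ∏ t : N, (X - C ((t : D) • x)) = ∏ t : N, (X - C ((t : D) • x)) := by
  rw [smul_prod_X_sub_C]
  exact Fintype.prod_bijective (t₀ * ·) (Group.mulLeft_bijective t₀) _ _ fun t => by
    rw [Subgroup.coe_mul, mul_smul]

/-- **Tate's argument for Serre's Proposition IV.3.**  Setting: `S` a Dedekind domain with a group
`D` acting, commuting with the scalars `A`; `𝔓` a nonzero prime of `S` *fixed by `D`*; a
generator `x` with `d S ⊆ A[x]`, `d ∉ 𝔓` (`exists_generator_smul_mem_adjoin`, so that
`i_D(g) = v_𝔓(g x - x)`, Lemma IV.1.1), `i_D(g) = ∞` only for `g = 1`; `N ≤ D` a finite subgroup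
and `s ∈ D`.  Put `b = ∏_{t ∈ N} (x - s t x)`, so `v_𝔓(b) = Σ_{t ∈ N} i_D(s t)`.  Then:
(1) every `N`-invariant `y ∈ S` has `v_𝔓(s y - y) ≥ v_𝔓(b)` (Tate: `d y = P(x)`, `P ∈ A[X]`,
`P - d y = f h` with `f = ∏_{t ∈ N}(X - t x)`, so `d (y - s y) = (s f)(x) (s h)(x)`), and
(2) some `N`-invariant `y₀` (a coefficient of `f`) attains `v_𝔓(s y₀ - y₀) = v_𝔓(b)` (as
`b = (s f - f)(x)` is a combination of the `s c - c`, `c` a coefficient of `f`).  In Serre's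
setting `y₀` is the generator `y` of `A_{K'}` and (1)–(2) read `v_L(s y - y) = v_L(b)`, i.e.
`e' i_{G/H}(σ) = Σ_{s → σ} i_G(s)`.
Ref: Serre, *Local Fields*, Ch. IV §1, Prop. 3 (proof, after Tate).
[cite: SerreLocalFields1979, Ch. IV §1 Prop. 3] -/
theorem tate_sum_lowerIndex [Fintype N] {𝔓 : Ideal S} [𝔓.IsPrime] (h𝔓 : 𝔓 ≠ ⊥)
    (hstab : ∀ g : D, g • 𝔓 = 𝔓) (hN1 : ∀ g : D, lowerIndex 𝔓 D g = ⊤ → g = 1)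
    {x : S} {d : A} (hd : algebraMap A S d ∉ 𝔓) (hgen : ∀ b : S, ∃ P : A[X], d • b = aeval x P)
    (s : D) :
    (∀ y : S, (∀ t : N, (t : D) • y = y) → ∑ t : N, lowerIndex 𝔓 D (s * t) ≤ ordIdeal 𝔓 (s • y - y)) ∧
      ∃ y₀ : S, (∀ t : N, (t : D) • y₀ = y₀) ∧ ordIdeal 𝔓 (s • y₀ - y₀) = ∑ t : N, lowerIndex 𝔓 D (s * t) := by
  classical
  have hiS : ∀ g : D, lowerIndex 𝔓 D g = ordIdeal 𝔓 (g • x - x) := lowerIndex_eq_ordIdeal h𝔓 hstab hd hgen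
  -- the polynomial `f` and `b = (s • f)(x)`
  set f : S[X] := ∏ t : N, (X - C ((t : D) • x)) with hf
  have hfx : f.eval x = 0 := by
    rw [hf, Polynomial.eval_prod]
    exact Finset.prod_eq_zero (Finset.mem_univ (1 : N)) (by simp)
  have hb : (s • f).eval x = ∏ t : N, (x - s • (t : D) • x) := by
    rw [hf, smul_prod_X_sub_C, Polynomial.eval_prod]
    simp only [Polynomial.eval_sub, Polynomial.eval_X, Polynomial.eval_C]
  have hordb : ordIdeal 𝔓 ((s • f).eval x) = ∑ t : N, lowerIndex 𝔓 D (s * t) := by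
    rw [hb, ordIdeal_prod h𝔓]
    refine Finset.sum_congr rfl fun t _ => ?_
    rw [hiS, mul_smul, ordIdeal_sub_comm]
  -- coefficients of `f` are `N`-invariant
  have hcoeff : ∀ (k : ℕ) (t : N), (t : D) • f.coeff k = f.coeff k := fun k t => by
    rw [← Polynomial.coeff_smul, hf, subgroup_smul_prod_X_sub_C]
  -- (1): `v(b) ≤ v(s y - y)` for `N`-invariant `y`
  have h1 : ∀ y : S, (∀ t : N, (t : D) • y = y) →
      ordIdeal 𝔓 ((s • f).eval x) ≤ ordIdeal 𝔓 (s • y - y) := by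
    intro y hy
    obtain ⟨P, hP⟩ := hgen y
    set g₀ : S[X] := P.map (algebraMap A S) - C (d • y) with hg₀
    -- every `t • x`, `t ∈ N`, is a root of `g₀`
    have hroot : ∀ t : N, g₀.eval ((t : D) • x) = 0 := fun t => by
      rw [hg₀, Polynomial.eval_sub, Polynomial.eval_C, Polynomial.eval_map_algebraMap,
        ← smul_aeval, ← hP, Algebra.smul_def, smul_mul', smul_algebraMap, hy, sub_self]
    -- the `t • x` are distinct
    have hinj : Function.Injective fun t : N => (t : D) • x := by
      intro t₁ t₂ h
      have h' : ((t₂ : D)⁻¹ * t₁) • x = x := by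
        rw [mul_smul]
        exact inv_smul_eq_iff.mpr (by exact h)
      have htop : lowerIndex 𝔓 D ((t₂ : D)⁻¹ * t₁) = ⊤ := by rw [hiS, h', sub_self, ordIdeal_zero]
      have := hN1 _ htop
      rw [inv_mul_eq_one] at this
      exact Subtype.ext this.symm
    -- hence `f ∣ g₀`
    have hdvd : f ∣ g₀ := by
      by_cases hg0 : g₀ = 0
      · rw [hg0]; exact dvd_zero f
      have hfprod : f = ((Finset.univ.val.map fun t : N => (t : D) • x).map fun a => X - C a).prod := by
        rw [hf, Finset.prod_eq_multiset_prod, Multiset.map_map]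
        rfl
      rw [hfprod, Multiset.prod_X_sub_C_dvd_iff_le_roots hg0,
        Multiset.le_iff_subset (Finset.univ.nodup.map hinj)]
      intro r hr
      obtain ⟨t, -, rfl⟩ := Multiset.mem_map.mp hr
      exact (Polynomial.mem_roots hg0).mpr (hroot t)
    obtain ⟨h, hh⟩ := hdvd
    -- apply `s` and evaluate at `x`
    have hsg₀ : s • g₀ = P.map (algebraMap A S) - C (d • s • y) := by
      rw [hg₀, smul_sub, Polynomial.smul_C, Algebra.smul_def, smul_mul', smul_algebraMap,
        ← Algebra.smul_def]
      congr 1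
      ext k
      rw [Polynomial.coeff_smul, Polynomial.coeff_map, smul_algebraMap]
    have hev : algebraMap A S d * (y - s • y) = (s • f).eval x * (s • h).eval x := by
      have := congrArg (fun q : S[X] => (s • q).eval x) hh
      simp only [smul_mul', Polynomial.eval_mul] at this
      rw [← this, hsg₀, Polynomial.eval_sub, Polynomial.eval_C, Polynomial.eval_map_algebraMap,
        ← hP, Algebra.smul_def, Algebra.smul_def, mul_sub]
    have := congrArg (fun c => ordIdeal 𝔓 c) hev
    rw [ordIdeal_mul h𝔓, ordIdeal_mul h𝔓, ordIdeal_eq_zero_iff.mpr hd, zero_add,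
      ordIdeal_sub_comm] at this
    rw [this]
    exact le_self_add
  refine ⟨fun y hy => hordb ▸ h1 y hy, ?_⟩
  -- (2): some coefficient `c` of `f` has `v(s c - c) ≤ v(b)`; with (1) it attains `v(b)`
  by_contra hne
  push Not at hne
  have hlt : ∀ k, ordIdeal 𝔓 ((s • f).eval x) < ordIdeal 𝔓 (s • f.coeff k - f.coeff k) := fun k =>
    lt_of_le_of_ne (h1 _ (hcoeff k)) (fun h => hne (f.coeff k) (hcoeff k) (hordb ▸ h.symm))
  -- `b = (s f - f)(x) = Σ_k (s c_k - c_k) x^k` has order `> v(b)`: contradiction unless `b = 0`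
  have heq : (s • f).eval x = (s • f - f).eval x := by rw [Polynomial.eval_sub, hfx, sub_zero]
  have hfin : ordIdeal 𝔓 ((s • f).eval x) ≠ ⊤ := by
    intro htop
    -- then some `s t x = x`, so `s t = 1`, and `y₀ = 0`... we produce the witness directly
    apply hne 0 (fun t => smul_zero _)
    rw [smul_zero, sub_zero, ordIdeal_zero, ← hordb, htop]
  obtain ⟨m, hm⟩ := ENat.ne_top_iff_exists.mp hfin
  have hbig : ((m + 1 : ℕ) : ℕ∞) ≤ ordIdeal 𝔓 ((s • f).eval x) := by
    rw [heq, Polynomial.eval_eq_sum_range]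
    refine le_ordIdeal_sum _ _ fun k _ => ?_
    rw [ordIdeal_mul h𝔓, Polynomial.coeff_sub, Polynomial.coeff_smul]
    refine le_trans ?_ le_self_add
    have := hlt k
    rw [← hm] at this
    exact Order.add_one_le_of_lt (by exact_mod_cast this)
  rw [← hm] at hbig
  have : m + 1 ≤ m := by exact_mod_cast hbig
  omega

end Tate

/-! ### Density of `S^H` in `S^{H ∩ D}` at a prime `𝔓` (decomposition field: `e = f = 1`) -/

section Density

open scoped Pointwise

variable {S : Type*} [CommRing S] {G : Type*} [Group G] [MulSemiringAction G S]

/-- A conjugate `g • 𝔓` of a maximal ideal is maximal. [folklore] -/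
theorem smul_isMaximal (g : G) (𝔓 : Ideal S) [h : 𝔓.IsMaximal] : (g • 𝔓).IsMaximal := by
  rw [Ideal.pointwise_smul_eq_comap]
  exact Ideal.comap_isMaximal_of_surjective _ (RingEquiv.surjective _)

/-- A product of elements `≡ 1 mod J` is `≡ 1 mod J`. [folklore] -/
theorem prod_sub_one_mem {ι : Type*} (s : Finset ι) (f : ι → S) (J : Ideal S)
    (h : ∀ i ∈ s, f i - 1 ∈ J) : (∏ i ∈ s, f i) - 1 ∈ J := by
  refine Finset.prod_induction f (fun u => u - 1 ∈ J) (fun a b ha hb => ?_) (by simp) h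
  have : a * b - 1 = (a - 1) * b + (b - 1) := by ring
  rw [this]
  exact J.add_mem (J.mul_mem_right _ ha) hb

/-- **The decomposition ring is `𝔓`-adically generated by the ring below** (the content of
`e = f = 1` for the decomposition field; Serre I §7 Prop. 21 c), Neukirch I (9.3)).  Let `G` act
on `S`, `𝔓` a maximal ideal with decomposition group `D = {g | g 𝔓 = 𝔓}`, `H ≤ G` finite.  Then
every `c ∈ S` fixed by `H ∩ D` is congruent modulo `𝔓ᴹ`, for every `M`, to an `H`-invariant
element.  Proof: the ideal `I = ∏_{h ∈ H, h𝔓 ≠ 𝔓} (h 𝔓)ᴹ` is prime to `𝔓ᴹ` and stable under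
`H ∩ D`; from `1 = a + b₀` (`a ∈ 𝔓ᴹ`, `b₀ ∈ I`) the norm `b = ∏_{n ∈ H ∩ D} n b₀ ∈ I` is
`H ∩ D`-invariant and `≡ 1 mod 𝔓ᴹ`; then `y = Σ_r r (b c)` over representatives `r` of
`H/(H ∩ D)` is `H`-invariant and `y ≡ b c ≡ c mod 𝔓ᴹ` (`r (b c) ∈ r I ⊆ 𝔓ᴹ` for `r ∉ D`).
Ref: Serre, *Local Fields*, Ch. I §7, Prop. 21 (decomposition field); Neukirch, *Algebraic
Number Theory*, Ch. I §9, Prop. (9.3). [folklore] -/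
theorem exists_invariant_sub_mem_pow (𝔓 : Ideal S) [𝔓.IsMaximal] (H : Subgroup G) [Finite H]
    (c : S) (hc : ∀ h : H, (h : G) • 𝔓 = 𝔓 → (h : G) • c = c) (M : ℕ) :
    ∃ y : S, (∀ h : H, (h : G) • y = y) ∧ y - c ∈ 𝔓 ^ M := by
  classical
  haveI := Fintype.ofFinite H
  -- the subgroup `N = H ∩ D` of `H`
  let N : Subgroup H :=
    { carrier := {h | (h : G) • 𝔓 = 𝔓}
      mul_mem' := fun {a b} ha hb => by
        change ((a : G) * b) • 𝔓 = 𝔓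
        rw [mul_smul, hb, ha]
      one_mem' := one_smul G 𝔓
      inv_mem' := fun {a} ha => by
        change (a : G)⁻¹ • 𝔓 = 𝔓
        exact inv_smul_eq_iff.mpr ha.symm }
  have hN : ∀ h : H, h ∈ N ↔ (h : G) • 𝔓 = 𝔓 := fun h => Iff.rfl
  -- the ideal `I`
  let I : Ideal S := ∏ h ∈ Finset.univ.filter (fun h : H => (h : G) • 𝔓 ≠ 𝔓), ((h : G) • 𝔓) ^ M
  have hIle : ∀ h : H, (h : G) • 𝔓 ≠ 𝔓 → I ≤ ((h : G) • 𝔓) ^ M := fun h hh =>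
    (Ideal.prod_le_inf).trans (Finset.inf_le (Finset.mem_filter.mpr ⟨Finset.mem_univ _, hh⟩))
  have hcop : 𝔓 ^ M ⊔ I = ⊤ := by
    refine Ideal.sup_prod_eq_top fun h hh => ?_
    rw [Finset.mem_filter] at hh
    haveI := smul_isMaximal (h : G) 𝔓
    exact Ideal.pow_sup_pow_eq_top ((Ideal.IsMaximal.coprime_of_ne inferInstance inferInstance
      (Ne.symm hh.2)))
  -- `1 = a + b₀`
  obtain ⟨a, ha, b₀, hb₀, hab⟩ := Submodule.mem_sup.mp
    ((Ideal.eq_top_iff_one _).mp hcop)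
  -- the norm `b = ∏_{n ∈ N} n • b₀`
  let b : S := ∏ n : N, ((n : H) : G) • b₀
  have hbI : b ∈ I := by
    obtain ⟨k, hk⟩ := Finset.dvd_prod_of_mem (fun n : N => ((n : H) : G) • b₀) (Finset.mem_univ 1)
    change b = _ at hk
    rw [hk]
    simp only [OneMemClass.coe_one, one_smul]
    exact I.mul_mem_right _ hb₀
  have hb1 : b - 1 ∈ 𝔓 ^ M := by
    refine prod_sub_one_mem _ _ _ fun n _ => ?_
    have h1 : ((n : H) : G) • (a + b₀) = 1 := by rw [hab, smul_one]
    have : ((n : H) : G) • b₀ - 1 = -(((n : H) : G) • a) := by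
      rw [smul_add] at h1
      linear_combination h1
    rw [this, neg_mem_iff]
    have hna : ((n : H) : G) • a ∈ ((n : H) : G) • 𝔓 ^ M := Ideal.smul_mem_pointwise_smul _ _ _ ha
    rwa [smul_pow', (hN n).mp n.2] at hna
  have hbN : ∀ n : N, ((n : H) : G) • b = b := fun n => by
    simp only [b, Finset.smul_prod', ← mul_smul, ← Subgroup.coe_mul]
    exact Fintype.prod_bijective (n * ·) (Group.mulLeft_bijective n) _ _ fun _ => rfl
  -- `c' = b c`
  set c' := b * c with hc'
  have hc'N : ∀ n : N, ((n : H) : G) • c' = c' := fun n => by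
    rw [hc', smul_mul', hbN, hc n ((hN n).mp n.2)]
  have hc'c : c' - c ∈ 𝔓 ^ M := by
    have : c' - c = (b - 1) * c := by rw [hc']; ring
    rw [this]
    exact Ideal.mul_mem_right _ _ hb1
  have hc'I : c' ∈ I := I.mul_mem_right _ hbI
  -- the sum over coset representatives of `N` in `H`
  let y : S := ∑ q : H ⧸ N, ((q.out : H) : G) • c'
  have hrep : ∀ (u v : H), (QuotientGroup.mk u : H ⧸ N) = QuotientGroup.mk v →
      (u : G) • c' = (v : G) • c' := by
    intro u v huv
    have hn : u⁻¹ * v ∈ N := QuotientGroup.eq.mp huv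
    calc (u : G) • c' = (u : G) • ((((⟨u⁻¹ * v, hn⟩ : N) : H) : G) • c') := by rw [hc'N]
      _ = ((u * (u⁻¹ * v) : H) : G) • c' := by
          simp only [Subgroup.coe_mul, Subgroup.coe_inv, mul_smul]
      _ = (v : G) • c' := by rw [mul_inv_cancel_left]
  refine ⟨y, fun h => ?_, ?_⟩
  · -- `H`-invariance
    simp only [y, Finset.smul_sum, ← mul_smul, ← Subgroup.coe_mul]
    refine Fintype.sum_bijective (h • ·) (MulAction.bijective h) _ _ fun q => hrep _ _ ?_
    rw [QuotientGroup.out_eq', ← smul_eq_mul, ← MulAction.Quotient.smul_mk, QuotientGroup.out_eq']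
  · -- `y ≡ c' ≡ c mod 𝔓ᴹ`
    have hsplit : y = ((Quotient.out (QuotientGroup.mk (1 : H) : H ⧸ N) : H) : G) • c' +
        ∑ q ∈ Finset.univ.erase (QuotientGroup.mk (1 : H) : H ⧸ N), ((q.out : H) : G) • c' :=
      (Finset.add_sum_erase _ _ (Finset.mem_univ _)).symm
    have h0 : ((Quotient.out (QuotientGroup.mk (1 : H) : H ⧸ N) : H) : G) • c' = c' := by
      rw [hrep _ 1 (QuotientGroup.out_eq' _), OneMemClass.coe_one, one_smul]
    have hrest : ∀ q ∈ Finset.univ.erase (QuotientGroup.mk (1 : H) : H ⧸ N),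
        ((q.out : H) : G) • c' ∈ 𝔓 ^ M := by
      intro q hq
      have hqN : q.out ∉ N := fun hmem => (Finset.mem_erase.mp hq).1 (by
        rw [← QuotientGroup.out_eq' q, QuotientGroup.eq]
        simpa using N.inv_mem hmem)
      have hne : ((q.out : H) : G)⁻¹ • 𝔓 ≠ 𝔓 := fun heq => hqN ((hN _).mpr (by
        have := congrArg (((q.out : H) : G) • ·) heq
        simpa only [smul_inv_smul] using this.symm))
      have hle := hIle (q.out)⁻¹ (by rwa [Subgroup.coe_inv])
      have : ((q.out : H) : G) • c' ∈ ((q.out : H) : G) • ((((q.out : H) : G)⁻¹ • 𝔓) ^ M) :=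
        Ideal.smul_mem_pointwise_smul _ _ _ (hle hc'I)
      rwa [smul_pow', smul_inv_smul] at this
    have hyc' : y - c' ∈ 𝔓 ^ M := by
      rw [hsplit, h0, add_sub_cancel_left]
      exact Ideal.sum_mem _ hrest
    have : y - c = (y - c') + (c' - c) := by ring
    rw [this]
    exact Ideal.add_mem _ hyc' hc'c

end Density

/-! ### Helpers for the assembly of Prop. IV.3 -/

section Helpers

open scoped Pointwise

variable {S : Type*} [CommRing S] {G : Type*} [Group G] [MulSemiringAction G S] {𝔓 : Ideal S}

/-- Elements outside the decomposition group have `i_G = 0`.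
Ref: Serre, *Local Fields*, Ch. IV §1 (`G_0 ⊆ D`). [folklore] -/
theorem lowerIndex_eq_zero_of_smul_ne {g : G} (hg : g • 𝔓 ≠ 𝔓) : lowerIndex 𝔓 G g = 0 :=
  (lowerIndex_eq_zero_iff 𝔓).mpr fun h => hg h.1

/-- At the zero ideal of a ring with faithful action, `i_G(g) = 0` for `g ≠ 1` (and `∞` for
`g = 1`). [folklore] -/
theorem lowerIndex_bot_of_ne_one [FaithfulSMul G S] {g : G} (hg : g ≠ 1) : lowerIndex (⊥ : Ideal S) G g = 0 := by
  rw [lowerIndex_eq_zero_iff]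
  rintro ⟨-, h⟩
  apply hg
  apply FaithfulSMul.eq_of_smul_eq_smul (α := S)
  intro x
  have := h x
  rw [zero_add, pow_one, Submodule.mem_toAddSubgroup, Ideal.mem_bot, sub_eq_zero] at this
  rw [this, one_smul]

/-- **`i_Q(σ) = v_𝔮(σ t₀ - t₀)` for a minimizing `t₀`** (the characterization behind Serre's
`i_G(s) = v_L(s x - x)`, with the minimality supplied as a hypothesis).
Ref: Serre, *Local Fields*, Ch. IV §1, Lemma 1. [folklore] -/
theorem lowerIndex_eq_ordIdeal_of_forall_le [IsDedekindDomain S] [𝔓.IsPrime] {σ : G} (hσ : σ • 𝔓 = 𝔓)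
    {t₀ : S} (hmin : ∀ t : S, ordIdeal 𝔓 (σ • t₀ - t₀) ≤ ordIdeal 𝔓 (σ • t - t)) :
    lowerIndex 𝔓 G σ = ordIdeal 𝔓 (σ • t₀ - t₀) := by
  refine le_antisymm ?_ ?_ <;> refine ENat.forall_natCast_le_iff_le.mp fun n hn => ?_ <;>
    rcases n with _ | n
  · exact bot_le
  · rw [le_ordIdeal_iff_mem_pow]
    rw [Nat.cast_succ, add_one_le_lowerIndex_iff] at hn
    exact hn.2 t₀
  · exact bot_le
  · have hb : ∀ t : S, σ • t - t ∈ 𝔓 ^ (n + 1) := fun t =>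
      le_ordIdeal_iff_mem_pow.mp (le_trans hn (hmin t))
    rw [Nat.cast_succ, add_one_le_lowerIndex_iff]
    exact ⟨hσ, fun t => hb t⟩

/-- A domain finite over `ℤ` has finite residue rings at nonzero primes. [folklore] -/
theorem finite_quotient_of_moduleFinite_int [IsDomain S] [Module.Finite ℤ S] (h𝔓 : 𝔓 ≠ ⊥)
    [𝔓.IsPrime] : Finite (S ⧸ 𝔓) := by
  haveI : Algebra.IsIntegral ℤ S := Algebra.IsIntegral.of_finite ℤ S
  have hp : 𝔓.under ℤ ≠ ⊥ := Ideal.IsIntegral.comap_ne_bot ℤ h𝔓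
  haveI : Finite (ℤ ⧸ 𝔓.under ℤ) := Ideal.finiteQuotientOfFreeOfNeBot _ hp
  exact Module.finite_of_finite (ℤ ⧸ 𝔓.under ℤ)

end Helpers

/-! ### `e(𝔓 | 𝔓 ∩ T) = #H_0` (Hilbert theory, from Mathlib) -/

section CardInertia

open scoped Pointwise

variable {T S : Type*} [CommRing T] [CommRing S] [Algebra T S] [IsDedekindDomain T]
  [IsDedekindDomain S] (H : Type*) [Group H] [MulSemiringAction H S] [Finite H]
  [IsGaloisGroup H T S] [Module.Finite T S] [FaithfulSMul T S]

/-- For a finite Galois group `H` of `S/T` (Dedekind domains, `T → S` injective and finite, residue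
field of `𝔮 = 𝔓 ∩ T` finite): the multiplicity of `𝔓` in `𝔮 S` — the ramification index
`e(𝔓|𝔮)` — equals `#I_𝔓(H)`, the order of the inertia group (Mathlib's
`Ideal.card_inertia_eq_ramificationIdxIn`, the `e f g = n` theory).
Ref: Serre, *Local Fields*, Ch. I §7, Prop. 20–21 and Cor. (order of the inertia group `= e`
for separable residue extension). [folklore] -/
theorem emultiplicity_map_under_eq_card_inertia (𝔓 : Ideal S) [𝔓.IsMaximal] (h𝔓 : 𝔓 ≠ ⊥)
    [Finite (T ⧸ 𝔓.under T)] :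
    emultiplicity 𝔓 ((𝔓.under T).map (algebraMap T S)) = Nat.card (𝔓.inertia H) := by
  classical
  haveI : Module.IsTorsionFree T S := Module.isTorsionFree_iff_faithfulSMul.mpr inferInstance
  haveI : (𝔓.under T).IsMaximal := Ideal.IsMaximal.under T 𝔓
  haveI : Finite (𝔓.under T).ResidueField :=
    Finite.of_surjective _ (Ideal.bijective_algebraMap_quotient_residueField (𝔓.under T)).2
  haveI : PerfectField (𝔓.under T).ResidueField := PerfectField.ofFinite
  have h1 := Ideal.card_inertia_eq_ramificationIdxIn (G := H) (𝔓.under T) 𝔓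
  have h2 := Ideal.ramificationIdxIn_eq_ramificationIdx (𝔓.under T) 𝔓 H
  have hmap : (𝔓.under T).map (algebraMap T S) ≠ ⊥ := by
    rw [Ne, Ideal.map_eq_bot_iff_of_injective (FaithfulSMul.algebraMap_injective T S)]
    exact Ideal.IsIntegral.comap_ne_bot T h𝔓
  have h3 := Ideal.IsDedekindDomain.ramificationIdx_eq_normalizedFactors_count (𝔓.under T) 𝔓 hmap
  have h4 := UniqueFactorizationMonoid.emultiplicity_eq_count_normalizedFactors
    (Ideal.prime_of_isPrime h𝔓 inferInstance).irreducible hmap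
  rw [h4, normalize_eq, ← h3, ← h2, ← h1]

end CardInertia

/-! ### Serre's Prop. IV.3 for Galois quotient data -/

section Main

open scoped Pointwise
open Polynomial

variable {S T : Type*} [CommRing S] [CommRing T] (𝔓 : Ideal S) {G Q : Type*} [Group G] [Group Q]
  [MulSemiringAction G S] [MulSemiringAction Q T] (π : G →* Q) (ι : T →+* S)

/-- A finite sum in `ℕ∞` containing the term `∞` is `∞`. [folklore] -/
theorem finsum_eq_top_of_eq_top {α : Type*} [Finite α] {f : α → ℕ∞} (a : α) (ha : f a = ⊤) :
    ∑ᶠ x, f x = ⊤ := by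
  classical
  haveI := Fintype.ofFinite α
  rw [finsum_eq_sum_of_fintype]
  exact WithTop.sum_eq_top.mpr ⟨a, Finset.mem_univ _, ha⟩

/-- **Serre's Proposition IV.3, core form**:
`e' · i_{G/H}(σ) = Σ_{s → σ} i_G(s)` with `e' = #H_0`, for Galois quotient data
`(S, T, G, Q, π, ι)` over Dedekind domains, granted: a base ring `R₀` over which `S` is finite and
whose scalars commute with `G` (`R₀ = ℤ`, or the Dedekind ring `R` of Serre's setting), the
separability of the residue extension of `𝔓` over `𝔓 ∩ R₀` (Serre's standing hypothesis), and
the equality `e(𝔓 | 𝔓 ∩ T) = #H_0` (`#T = e`, Ch. I §7 Cor. to Prop. 21; hypothesis `hcard`,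
supplied from Mathlib's Hilbert theory by the users).  Proof.  Let `H = ker π`, `D` the decomposition group of `𝔓`,
`𝔮 = 𝔓 ∩ T`.  (o) `𝔓 = 0`: all ramification groups are trivial (faithfulness) and both sides
are `∞` or `0` according as `π s = 1` or not.  (i) If no lift `s t` fixes `𝔓`, both sides
vanish: `π s ∉ (G/H)_0`, for otherwise `s` acts trivially on `S^H` modulo `𝔓`, so `s⁻¹𝔓` and
`𝔓` lie over the same prime of `T` and are `H`-conjugate (Mathlib
`Algebra.IsInvariant.exists_smul_of_under_eq`), i.e. some `s t ∈ D`.  (ii) Otherwise we may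
assume `s ∈ D` (both sides only depend on the coset `s H`); if moreover `s ∈ H` both sides are
`∞`.  (iii) For `s ∈ D ∖ H`: by Prop. III.12 (`exists_generator_smul_mem_adjoin`, for the group
`D` and its ring of invariants) there is a generator `x` with `i_G(g) = v_𝔓(g x - x)` on `D`
(Lemma IV.1.1); Tate's argument (`tate_sum_lowerIndex` for `N = H ∩ D`) gives
`v_𝔓(s y - y) ≥ μ := Σ_{t ∈ H ∩ D} i_G(s t) = Σ_{t ∈ H} i_G(s t)` for all `y ∈ S^{H ∩ D}`, with
equality for some `y₀`; by the density of `S^H` in `S^{H ∩ D}` at `𝔓`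
(`exists_invariant_sub_mem_pow`, i.e. `e = f = 1` for the decomposition field) equality is
attained at some `y₁ = ι(t₁) ∈ S^H`.  As `v_𝔓 ∘ ι = e(𝔓|𝔮) · v_𝔮` (`ordIdeal_algebraMap`, `T`
Dedekind), `t₁` minimizes `v_𝔮(σ t - t)` over `T`, so `i_{G/H}(σ) = v_𝔮(σ t₁ - t₁)` and
`e(𝔓|𝔮) · i_{G/H}(σ) = v_𝔓(s y₁ - y₁) = μ`; finally `e(𝔓|𝔮) = #H_0` (Mathlib's Hilbert theory,
`Ideal.card_inertia_eq_ramificationIdxIn`, finite residue fields being perfect).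
Ref: Serre, *Local Fields*, Ch. IV §1, Prop. 3 and Remark 2; Ch. III §6, Prop. 12; Ch. I §7,
Prop. 20–22. [cite: SerreLocalFields1979, Ch. IV §1 Prop. 3] -/
theorem card_mul_lowerIndex_map_eq_finsum [IsDedekindDomain S] [IsDedekindDomain T] [Finite G]
    [FaithfulSMul G S] [FaithfulSMul Q T] [𝔓.IsMaximal]
    (hι : Function.Injective ι) (hequiv : ∀ (g : G) (t : T), ι (π g • t) = g • ι t)
    (hfix : ∀ a : S, (∀ h : π.ker, (h : G) • a = a) → a ∈ Set.range ι)
    (R₀ : Type*) [CommRing R₀] [Algebra R₀ S] [Module.Finite R₀ S] [SMulCommClass G R₀ S]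
    (hsep : 𝔓 ≠ ⊥ → Algebra.IsSeparable (R₀ ⧸ 𝔓.under R₀) (S ⧸ 𝔓))
    (hcard : 𝔓 ≠ ⊥ → emultiplicity 𝔓 ((𝔓.comap ι).map ι) = Nat.card (𝔓.inertia π.ker))
    (s : G) :
    (Nat.card (𝔓.ramificationSubgroup π.ker 0) : ℕ∞) * lowerIndex (𝔓.comap ι) Q (π s) =
      ∑ᶠ t : π.ker, lowerIndex 𝔓 G (s * t) := by
  classical
  haveI := Fintype.ofFinite G
  haveI : Fintype π.ker := Fintype.ofFinite _
  -- `T → S` as an algebra, with Galois group `H = ker π`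
  letI : Algebra T S := ι.toAlgebra
  have halg : algebraMap T S = ι := rfl
  have hHfix : ∀ (h : π.ker) (a : T), (h : G) • ι a = ι a := fun h a => by
    rw [← hequiv, h.2, one_smul]
  haveI : FaithfulSMul T S := (faithfulSMul_iff_algebraMap_injective T S).mpr hι
  haveI : IsGaloisGroup π.ker T S :=
    { faithful := inferInstance
      commutes := ⟨fun h a b => by
        change (h : G) • (a • b) = a • (h : G) • b
        rw [Algebra.smul_def, Algebra.smul_def, smul_mul', halg, hHfix]⟩
      isInvariant := ⟨fun b hb => by
        obtain ⟨a, ha⟩ := hfix b fun h => hb h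
        exact ⟨a, ha⟩⟩ }
  haveI : Algebra.IsIntegral T S := Algebra.IsInvariant.isIntegral T S π.ker
  have h₀pos : 0 < Nat.card (𝔓.ramificationSubgroup π.ker 0) := Nat.card_pos
  -- a lift in the kernel direction gives the term `∞`
  have hker_top : ∀ (P : Ideal S) (s : G), π s = 1 →
      ∑ᶠ t : π.ker, lowerIndex P G (s * t) = ⊤ := fun P s hs => by
    refine finsum_eq_top_of_eq_top (⟨s⁻¹, by rw [MonoidHom.mem_ker, map_inv, hs, inv_one]⟩ : π.ker) ?_
    simp
  have hker_ne : ∀ (s : G), π s ≠ 1 → ∀ t : π.ker, s * t ≠ 1 := fun s hs t hst => hs (by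
    have : s = (t : G)⁻¹ := eq_inv_of_mul_eq_one_left hst
    rw [this, map_inv, t.2, inv_one])
  ------------------------------------------------------------------
  -- (o) the case `𝔓 = ⊥`
  ------------------------------------------------------------------
  by_cases h𝔓 : 𝔓 = ⊥
  · subst h𝔓
    have hbot : (⊥ : Ideal S).ramificationSubgroup π.ker 0 = ⊥ := by
      rw [eq_bot_iff]
      intro h hh
      rw [Subgroup.mem_bot]
      apply FaithfulSMul.eq_of_smul_eq_smul (α := S)
      intro x
      have := hh.2 x
      rw [zero_add, pow_one, Submodule.mem_toAddSubgroup, Ideal.mem_bot, sub_eq_zero] at this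
      rw [this, one_smul]
    rw [hbot, Subgroup.card_bot, Nat.cast_one, one_mul, Ideal.comap_bot_of_injective ι hι]
    by_cases hs : π s = 1
    · rw [hs, lowerIndex_one, hker_top ⊥ s hs]
    · rw [lowerIndex_bot_of_ne_one hs]
      refine (finsum_eq_zero_of_forall_eq_zero fun t => lowerIndex_bot_of_ne_one (hker_ne s hs t)).symm
  ------------------------------------------------------------------
  -- `𝔓 ≠ ⊥`: generalities
  ------------------------------------------------------------------
  haveI h𝔓prime : 𝔓.IsPrime := Ideal.IsMaximal.isPrime inferInstance
  obtain ⟨Nb, hNb⟩ := Ideal.ramificationSubgroup_eventually_eq_bot_holds 𝔓 G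
    (Ideal.IsMaximal.ne_top inferInstance)
  ------------------------------------------------------------------
  -- (iii)+(ii): the formula for `s ∈ D`
  ------------------------------------------------------------------
  have core : ∀ s : G, s • 𝔓 = 𝔓 →
      (Nat.card (𝔓.ramificationSubgroup π.ker 0) : ℕ∞) * lowerIndex (𝔓.comap ι) Q (π s) =
        ∑ᶠ t : π.ker, lowerIndex 𝔓 G (s * t) := by
    intro s hsD
    -- (ii) `s ∈ H`
    by_cases hsH : π s = 1
    · rw [hsH, lowerIndex_one, ENat.mul_top (by exact_mod_cast h₀pos.ne'), hker_top 𝔓 s hsH]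
    -- (iii) `s ∈ D ∖ H`: the decomposition group and its ring of invariants
    let D : Subgroup G := 𝔓.decompositionSubgroup G
    let sD : D := ⟨s, hsD⟩
    haveI : SMulCommClass D R₀ S := ⟨fun g r b => smul_comm (g : G) r b⟩
    let A : Subalgebra R₀ S := FixedPoints.subalgebra R₀ S D
    haveI : Algebra.IsInvariant A S D := ⟨fun b hb => ⟨⟨b, hb⟩, rfl⟩⟩
    haveI : Module.Finite A S := Module.Finite.of_restrictScalars_finite R₀ A S
    haveI : Algebra.IsIntegral A S := Algebra.IsInvariant.isIntegral A S D
    have hstabD : ∀ g : D, g • 𝔓 = 𝔓 := fun g => g.2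
    -- separability of the residue extension of `𝔓` over `𝔓 ∩ A` (from that over `𝔓 ∩ R₀`)
    haveI : Algebra.IsSeparable (A ⧸ 𝔓.under A) (S ⧸ 𝔓) := by
      haveI := hsep h𝔓
      haveI : (𝔓.under A).IsMaximal := Ideal.IsMaximal.under A 𝔓
      letI : Field (A ⧸ 𝔓.under A) := Ideal.Quotient.field _
      haveI : IsScalarTower (R₀ ⧸ 𝔓.under R₀) (A ⧸ 𝔓.under A) (S ⧸ 𝔓) :=
        IsScalarTower.of_algebraMap_eq fun r => by
          obtain ⟨r, rfl⟩ := Ideal.Quotient.mk_surjective r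
          rw [Ideal.Quotient.algebraMap_mk_of_liesOver, Ideal.Quotient.algebraMap_mk_of_liesOver,
            Ideal.Quotient.algebraMap_mk_of_liesOver, IsScalarTower.algebraMap_apply R₀ A S]
      exact Algebra.isSeparable_tower_top_of_isSeparable (R₀ ⧸ 𝔓.under R₀) (A ⧸ 𝔓.under A) (S ⧸ 𝔓)
    obtain ⟨x, d, hd, hgen⟩ := exists_generator_smul_mem_adjoin (A := A) D 𝔓 h𝔓 hstabD
    have hN1 : ∀ g : D, lowerIndex 𝔓 D g = ⊤ → g = 1 := fun g hg => by
      by_contra hg1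
      refine lowerIndex_ne_top 𝔓 (hNb Nb le_rfl) (fun h => hg1 (Subtype.ext h)) ?_
      rwa [lowerIndex_subgroup] at hg
    -- `N = H ∩ D` inside `D`, and Tate's argument
    let N₀ : Subgroup D := π.ker.subgroupOf D
    haveI : Fintype N₀ := Fintype.ofFinite _
    obtain ⟨hT1, y₀, hy₀N, hy₀⟩ := tate_sum_lowerIndex N₀ h𝔓 hstabD hN1 hd hgen sD
    set μ := ∑ t : N₀, lowerIndex 𝔓 D (sD * t) with hμdef
    -- elements of `H` fixing `𝔓` are elements of `N₀`
    have hHN₀ : ∀ (h : π.ker), (h : G) • 𝔓 = 𝔓 → ∀ y : S, (∀ t : N₀, (t : D) • y = y) →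
        (h : G) • y = y := fun h hh y hy =>
      hy ⟨⟨h, hh⟩, Subgroup.mem_subgroupOf.mpr h.2⟩
    have hHinv : ∀ y : S, (∀ h : π.ker, (h : G) • y = y) → ∀ t : N₀, (t : D) • y = y :=
      fun y hy t => hy ⟨((t : D) : G), Subgroup.mem_subgroupOf.mp t.2⟩
    -- `μ` is finite (`s ∉ H`)
    have hμtop : μ ≠ ⊤ := by
      intro htop
      obtain ⟨t, -, ht⟩ := WithTop.sum_eq_top.mp htop
      have h1 := hN1 _ ht
      have : s * ((t : D) : G) = 1 := congrArg Subtype.val h1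
      exact hker_ne s hsH ⟨((t : D) : G), Subgroup.mem_subgroupOf.mp t.2⟩ this
    obtain ⟨m, hm⟩ := ENat.ne_top_iff_exists.mp hμtop
    -- density: an `H`-invariant `y₁` with `v(s y₁ - y₁) = μ`
    obtain ⟨y₁, hy₁H, hy₁⟩ := exists_invariant_sub_mem_pow 𝔓 π.ker y₀
      (fun h hh => hHN₀ h hh y₀ hy₀N) (m + 1)
    have hord₁ : ordIdeal 𝔓 (s • y₁ - y₁) = m := by
      have hge : μ ≤ ordIdeal 𝔓 (s • y₁ - y₁) := hT1 y₁ (hHinv y₁ hy₁H)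
      have hdiff : (s • y₁ - y₁) - (s • y₀ - y₀) ∈ 𝔓 ^ (m + 1) := by
        have : (s • y₁ - y₁) - (s • y₀ - y₀) = s • (y₁ - y₀) - (y₁ - y₀) := by
          rw [smul_sub]; ring
        rw [this]
        refine Ideal.sub_mem _ ?_ hy₁
        have := Ideal.smul_mem_pointwise_smul s _ _ hy₁
        rwa [smul_pow', hsD] at this
      have hlt : ¬ ((m + 1 : ℕ) : ℕ∞) ≤ ordIdeal 𝔓 (s • y₁ - y₁) := fun hle => by
        have h2 : ((m + 1 : ℕ) : ℕ∞) ≤ ordIdeal 𝔓 (s • y₀ - y₀) := by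
          rw [le_ordIdeal_iff_mem_pow] at hle ⊢
          have := Ideal.sub_mem _ hle hdiff
          rwa [sub_sub_cancel] at this
        have hy₀' : ordIdeal 𝔓 (s • y₀ - y₀) = μ := hy₀
        rw [hy₀', ← hm] at h2
        have : m + 1 ≤ m := by exact_mod_cast h2
        omega
      rw [← hm] at hge
      obtain ⟨k, hk⟩ := ENat.ne_top_iff_exists.mp (ne_top_of_lt (not_le.mp hlt))
      rw [← hk] at hge hlt ⊢
      have h1 : m ≤ k := by exact_mod_cast hge
      have h2 : ¬ m + 1 ≤ k := fun h => hlt (by exact_mod_cast h)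
      congr 1
      omega
    obtain ⟨t₁, ht₁⟩ := hfix y₁ fun h => hy₁H h
    -- the `T`-side
    haveI : (𝔓.under T).IsMaximal := Ideal.IsMaximal.under T 𝔓
    have h𝔮 : 𝔓.under T ≠ ⊥ := Ideal.IsIntegral.comap_ne_bot T h𝔓
    have hle : (𝔓.under T).map (algebraMap T S) ≤ 𝔓 := Ideal.map_comap_le
    set e := emultiplicity 𝔓 ((𝔓.under T).map (algebraMap T S)) with hedef
    have he : e = Nat.card (𝔓.inertia π.ker) := hcard h𝔓
    have he0 : e ≠ 0 := by rw [he]; exact_mod_cast Nat.card_pos.ne'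
    have hetop : e ≠ ⊤ := by rw [he]; exact ENat.coe_ne_top _
    have hordT : ∀ u : T, ordIdeal 𝔓 (ι u) = ordIdeal (𝔓.under T) u * e := fun u =>
      ordIdeal_algebraMap h𝔓 h𝔮 hle u
    have hισ : ∀ u : T, ι (π s • u - u) = s • ι u - ι u := fun u => by rw [map_sub, hequiv]
    have hσ : π s • 𝔓.under T = 𝔓.under T := by
      ext u
      rw [Ideal.mem_pointwise_smul_iff_inv_smul_mem, Ideal.under_def, Ideal.mem_comap,
        Ideal.mem_comap, halg, ← map_inv, hequiv, ← Ideal.mem_pointwise_smul_iff_inv_smul_mem, hsD]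
    have hminT : ∀ u : T, ordIdeal (𝔓.under T) (π s • t₁ - t₁) ≤
        ordIdeal (𝔓.under T) (π s • u - u) := fun u => by
      rw [← ENat.mul_le_mul_right_iff he0 hetop, ← hordT, ← hordT, hισ, hισ, ht₁, hord₁, hm]
      exact hT1 (ι u) (hHinv (ι u) fun h => hHfix h u)
    have hiT : lowerIndex (𝔓.under T) Q (π s) = ordIdeal (𝔓.under T) (π s • t₁ - t₁) :=
      lowerIndex_eq_ordIdeal_of_forall_le hσ hminT
    -- the right-hand side is `μ`
    have hRHS : ∑ᶠ t : π.ker, lowerIndex 𝔓 G (s * t) = μ := by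
      rw [finsum_eq_sum_of_fintype, ← Finset.sum_filter_add_sum_filter_not Finset.univ
        (fun t : π.ker => (t : G) • 𝔓 = 𝔓)]
      have hzero : ∑ t ∈ Finset.univ.filter (fun t : π.ker => ¬ (t : G) • 𝔓 = 𝔓),
          lowerIndex 𝔓 G (s * t) = 0 := by
        refine Finset.sum_eq_zero fun t ht => lowerIndex_eq_zero_of_smul_ne fun hst => ?_
        rw [Finset.mem_filter] at ht
        apply ht.2
        rw [mul_smul] at hst
        have := congrArg (s⁻¹ • ·) hst
        simp only [inv_smul_smul] at this
        rw [this]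
        exact inv_smul_eq_iff.mpr hsD.symm
      rw [hzero, add_zero, hμdef]
      refine Finset.sum_bij (fun (t : π.ker) ht =>
        (⟨⟨(t : G), (Finset.mem_filter.mp ht).2⟩, Subgroup.mem_subgroupOf.mpr t.2⟩ : N₀))
        (fun t ht => Finset.mem_univ _) (fun t₁ ht₁ t₂ ht₂ h => ?_) (fun t' _ => ?_) (fun t ht => ?_)
      · exact Subtype.ext (congrArg (fun z : N₀ => ((z : D) : G)) h)
      · refine ⟨⟨((t' : D) : G), Subgroup.mem_subgroupOf.mp t'.2⟩,
          Finset.mem_filter.mpr ⟨Finset.mem_univ _, (t' : D).2⟩, rfl⟩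
      · rw [lowerIndex_subgroup]
        rfl
    -- conclusion
    rw [hRHS, ← hm, Ideal.ramificationSubgroup_zero]
    change (Nat.card (𝔓.inertia π.ker) : ℕ∞) * lowerIndex (𝔓.under T) Q (π s) = m
    rw [← he, hiT, mul_comm, ← hordT, hισ, ht₁, hord₁]
  ------------------------------------------------------------------
  -- (i)/(ii): reduce to `s ∈ D`
  ------------------------------------------------------------------
  by_cases hA : ∃ t : π.ker, (s * t) • 𝔓 = 𝔓
  · obtain ⟨t₀, ht₀⟩ := hA
    have h := core (s * t₀) ht₀
    rw [map_mul, t₀.2, mul_one] at h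
    rw [h]
    refine finsum_eq_of_bijective (fun t : π.ker => t₀ * t) (Group.mulLeft_bijective t₀) fun t => ?_
    simp only [Subgroup.coe_mul, mul_assoc]
  · -- (i) no lift fixes `𝔓`: both sides vanish
    push Not at hA
    have hRHS : ∑ᶠ t : π.ker, lowerIndex 𝔓 G (s * t) = 0 :=
      finsum_eq_zero_of_forall_eq_zero fun t => lowerIndex_eq_zero_of_smul_ne (hA t)
    rw [hRHS]
    suffices hL : lowerIndex (𝔓.comap ι) Q (π s) = 0 by rw [hL, mul_zero]
    rw [lowerIndex_eq_zero_iff]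
    intro hmem
    -- `s` acts trivially on `ι(T)` modulo `𝔓`, so `s⁻¹ 𝔓` lies over `𝔓 ∩ T`
    have hfixmod : ∀ a : T, s • ι a - ι a ∈ 𝔓 := fun a => by
      have := hmem.2 a
      rw [zero_add, pow_one, Submodule.mem_toAddSubgroup, Ideal.mem_comap, map_sub, hequiv] at this
      exact this
    haveI : (s⁻¹ • 𝔓).IsPrime := by
      rw [Ideal.pointwise_smul_eq_comap]; infer_instance
    have hunder : (𝔓).under T = (s⁻¹ • 𝔓).under T := by
      ext a
      rw [Ideal.under_def, Ideal.mem_comap, Ideal.mem_comap, halg,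
        Ideal.mem_pointwise_smul_iff_inv_smul_mem, inv_inv]
      constructor
      · intro ha
        have := Ideal.add_mem _ (hfixmod a) ha
        rwa [sub_add_cancel] at this
      · intro ha
        have := Ideal.sub_mem _ ha (hfixmod a)
        rwa [sub_sub_cancel] at this
    obtain ⟨g, hg⟩ := Algebra.IsInvariant.exists_smul_of_under_eq T S π.ker 𝔓 (s⁻¹ • 𝔓) hunder
    apply hA g
    have hg' : s⁻¹ • 𝔓 = (g : G) • 𝔓 := hg
    rw [mul_smul, ← hg', smul_inv_smul]

/-- **Serre's Prop. IV.3 as the tree's `IndexFormula`** (`HerbrandTheorem.lean`) for Galois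
quotient data over any base `R₀` with separable residue extension and `e(𝔓|𝔓 ∩ T) = #H_0`:
the core formula restricted to `s ∈ G_0 ∖ H`.
Ref: Serre, *Local Fields*, Ch. IV §1, Prop. 3. [cite: SerreLocalFields1979, Ch. IV §1 Prop. 3] -/
theorem indexFormula_of_galoisQuotientData [IsDedekindDomain S] [IsDedekindDomain T] [Finite G]
    [FaithfulSMul G S] [FaithfulSMul Q T] [𝔓.IsMaximal]
    (hι : Function.Injective ι) (hequiv : ∀ (g : G) (t : T), ι (π g • t) = g • ι t)
    (hfix : ∀ a : S, (∀ h : π.ker, (h : G) • a = a) → a ∈ Set.range ι)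
    (R₀ : Type*) [CommRing R₀] [Algebra R₀ S] [Module.Finite R₀ S] [SMulCommClass G R₀ S]
    (hsep : 𝔓 ≠ ⊥ → Algebra.IsSeparable (R₀ ⧸ 𝔓.under R₀) (S ⧸ 𝔓))
    (hcard : 𝔓 ≠ ⊥ → emultiplicity 𝔓 ((𝔓.comap ι).map ι) = Nat.card (𝔓.inertia π.ker)) :
    IndexFormula 𝔓 (𝔓.comap ι) π := fun s _ _ =>
  card_mul_lowerIndex_map_eq_finsum 𝔓 π ι hι hequiv hfix R₀ hsep hcard s

/-- **Serre's Prop. IV.3 for Galois quotient data over a Dedekind domain finite over `ℤ`**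
(number fields): the core form with `R₀ = ℤ`, the residue fields being finite (hence perfect, and
the residue extensions separable), and `e(𝔓 | 𝔓 ∩ T) = #H_0` by
`emultiplicity_map_under_eq_card_inertia` (Mathlib's Hilbert theory).
Ref: Serre, *Local Fields*, Ch. IV §1, Prop. 3 and Remark 2. [cite: SerreLocalFields1979, Ch. IV §1 Prop. 3] -/
theorem card_mul_lowerIndex_map_eq_finsum_of_moduleFinite_int [IsDedekindDomain S]
    [Module.Finite ℤ S] [IsDedekindDomain T] [Finite G] [FaithfulSMul G S] [FaithfulSMul Q T]
    [𝔓.IsMaximal] (hι : Function.Injective ι)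
    (hequiv : ∀ (g : G) (t : T), ι (π g • t) = g • ι t)
    (hfix : ∀ a : S, (∀ h : π.ker, (h : G) • a = a) → a ∈ Set.range ι) (s : G) :
    (Nat.card (𝔓.ramificationSubgroup π.ker 0) : ℕ∞) * lowerIndex (𝔓.comap ι) Q (π s) =
      ∑ᶠ t : π.ker, lowerIndex 𝔓 G (s * t) := by
  classical
  -- separability of the residue extension over `𝔓 ∩ ℤ` (finite fields)
  have hsep : 𝔓 ≠ ⊥ → Algebra.IsSeparable (ℤ ⧸ 𝔓.under ℤ) (S ⧸ 𝔓) := fun h𝔓 => by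
    haveI : Algebra.IsIntegral ℤ S := Algebra.IsIntegral.of_finite ℤ S
    haveI : (𝔓.under ℤ).IsMaximal := Ideal.IsMaximal.under ℤ 𝔓
    letI : Field (ℤ ⧸ 𝔓.under ℤ) := Ideal.Quotient.field _
    letI : Field (S ⧸ 𝔓) := Ideal.Quotient.field _
    haveI : Finite (ℤ ⧸ 𝔓.under ℤ) :=
      Ideal.finiteQuotientOfFreeOfNeBot _ (Ideal.IsIntegral.comap_ne_bot ℤ h𝔓)
    haveI : PerfectField (ℤ ⧸ 𝔓.under ℤ) := PerfectField.ofFinite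
    exact Algebra.IsAlgebraic.isSeparable_of_perfectField
  -- `e(𝔓 | 𝔓 ∩ T) = #H_0`
  have hcard : 𝔓 ≠ ⊥ → emultiplicity 𝔓 ((𝔓.comap ι).map ι) = Nat.card (𝔓.inertia π.ker) := by
    intro h𝔓
    letI : Algebra T S := ι.toAlgebra
    have halg : algebraMap T S = ι := rfl
    have hHfix : ∀ (h : π.ker) (a : T), (h : G) • ι a = ι a := fun h a => by
      rw [← hequiv, h.2, one_smul]
    haveI : FaithfulSMul T S := (faithfulSMul_iff_algebraMap_injective T S).mpr hι
    haveI : Module.Finite T S := Module.Finite.of_restrictScalars_finite ℤ T S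
    haveI : IsGaloisGroup π.ker T S :=
      { faithful := inferInstance
        commutes := ⟨fun h a b => by
          change (h : G) • (a • b) = a • (h : G) • b
          rw [Algebra.smul_def, Algebra.smul_def, smul_mul', halg, hHfix]⟩
        isInvariant := ⟨fun b hb => by
          obtain ⟨a, ha⟩ := hfix b fun h => hb h
          exact ⟨a, ha⟩⟩ }
    haveI : Finite (S ⧸ 𝔓) := finite_quotient_of_moduleFinite_int h𝔓
    haveI : Finite (T ⧸ 𝔓.under T) :=
      Finite.of_injective _ (Ideal.algebraMap_quotient_injective (I := 𝔓) (R := T))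
    exact emultiplicity_map_under_eq_card_inertia π.ker 𝔓 h𝔓
  exact card_mul_lowerIndex_map_eq_finsum 𝔓 π ι hι hequiv hfix ℤ hsep hcard s

end Main

/-! ### `e(𝔓 | 𝔓 ∩ T) = #I` as a multiplicity, with a separable residue extension -/

section CardInertiaSeparable

open scoped Pointwise
open Algebra

variable {R S G : Type*} [CommRing R] [CommRing S] [Algebra R S] [Group G]
  [MulSemiringAction G S] [IsGaloisGroup G R S] [Finite G]

/-- `e(𝔓 | 𝔓 ∩ T) = #I_𝔓(H)` as a multiplicity, for Dedekind domains with a separable residue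
extension (cf. `emultiplicity_map_under_eq_card_inertia` for finite residue fields), from
`card_inertia_eq_ramificationIdxIn_of_isSeparable` (`RamificationGalois.lean`).
Ref: Serre, *Local Fields*, Ch. I §7, Cor. to Prop. 21. [folklore] -/
theorem emultiplicity_map_under_eq_card_inertia_of_isSeparable {T : Type*} [CommRing T]
    [Algebra T S] [IsDedekindDomain T] [IsDedekindDomain S] (H : Type*) [Group H]
    [MulSemiringAction H S] [Finite H] [IsGaloisGroup H T S] [Module.Finite T S] [FaithfulSMul T S]
    (𝔓 : Ideal S) [𝔓.IsMaximal] (h𝔓 : 𝔓 ≠ ⊥) [(𝔓.under T).IsMaximal]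
    [Algebra.IsSeparable (T ⧸ 𝔓.under T) (S ⧸ 𝔓)] :
    emultiplicity 𝔓 ((𝔓.under T).map (algebraMap T S)) = Nat.card (𝔓.inertia H) := by
  classical
  haveI : Module.IsTorsionFree T S := Module.isTorsionFree_iff_faithfulSMul.mpr inferInstance
  have h1 := card_inertia_eq_ramificationIdxIn_of_isSeparable (G := H) (𝔓.under T) 𝔓
  have h2 := Ideal.ramificationIdxIn_eq_ramificationIdx (𝔓.under T) 𝔓 H
  have hmap : (𝔓.under T).map (algebraMap T S) ≠ ⊥ := by
    rw [Ne, Ideal.map_eq_bot_iff_of_injective (FaithfulSMul.algebraMap_injective T S)]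
    exact Ideal.IsIntegral.comap_ne_bot T h𝔓
  have h3 := Ideal.IsDedekindDomain.ramificationIdx_eq_normalizedFactors_count (𝔓.under T) 𝔓 hmap
  have h4 := UniqueFactorizationMonoid.emultiplicity_eq_count_normalizedFactors
    (Ideal.prime_of_isPrime h𝔓 inferInstance).irreducible hmap
  rw [h4, normalize_eq, ← h3, ← h2, ← h1]

end CardInertiaSeparable

end Literature.NumberTheory.GaloisRepresentations
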